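import Summits.FinalStateConjecture.FinalStateConjecture.Theses.StarvedNecks
import Literature.Geometry.Lorentzian.MinkowskiGlobalHyperbolicity
import Literature.Geometry.Lorentzian.KerrConvergenceProofs
import Literature.Geometry.Lorentzian.CausalFutureProofs
import Literature.Geometry.Lorentzian.CausalityPushUp
import Literature.Geometry.Lorentzian.KerrDataProofs
import Literature.Geometry.Lorentzian.KerrSchildCoord

/-!
# Disproof of `SeamedChartsExhaust` — findings (cdisprove seat, crux `stmt-FinalStateConjecture-13551`,
route `StarvedNecks`, rank 4). Cycle 1: `refuter-cdisprove-stmt-FinalStateConjecture-13551-0`;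
cycle 2 (this revision, 2026-08-16): `refuter-cdisprove-stmt-FinalStateConjecture-13551-g2-0`.

**Verdict after two cycles: the crux RESISTS — and is now PROVED in the tree
(`Theorems/StarvedNecksSeamedChartsExhaust.lean`); no refutation exists.** `SeamedChartsExhaust`
is a Lorentzian-bookkeeping lemma ("HonestCore ∧ SEAMED ∧ `O = J⁺(ιX) ∩ I⁻(charted)` ⇒
`HasExhaustiveCharts d`"); its proof plan (α)/(β) and — cycle 2 — the two REGISTERED STUBS of the picked
line `Lines/wide-anchoring.lean` (`stub_flatBoarding`, `stub_frontierBelowSlab`) check out on paper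
against their exact Lean text (see "Stubs"). Everything below is `sorry`-free, axioms
`propext`/`Classical.choice`/`Quot.sound`.

## What this file establishes

* §1 `seamedChartsExhaust_iff` (`Iff.rfl`) — READ-BACK with the two let-bound predicates named:
  `HonestCore 𝓢 O k d R₀` (4 clauses (a)–(d)) and `Seamed 𝓢 O d R R₀` (12 clauses (1)–(12)). The
  conclusion `HasExhaustiveCharts d` has EXISTENTIAL radii; the given `R` serve, and its clause (i) is
  `Seamed` (2) verbatim, so only the covering clause (ii)
  `∀ τ₁ > τ₀, O \ certifiedLate d R τ₁ ⊆ J⁻(certifiedSlab d R τ₁)` has content.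
* §2 `seamedChartsExhaust_of_core` — the crux follows from the spacetime-level core
  `SeamedChartsExhaustCore` (any time-oriented `𝓢 : Spacetime 4`, any set `Σ` in place of `ι(X)`), in
  which the following hypotheses are DELETED, hence decorative for this item: vacuum, maximality,
  admissibility of the data; `Kerr.IsSubextremal`; `100 Mᵢ ≤ R₀` beyond `r₊(Mᵢ,aᵢ) < R₀`
  (`rPlus_le_two_mul`); the two `C⁰` thresholds `Seamed` (3), (4) — because
  `TimeOrientation.IsFutureDirected v := IsCausal v ∧ g(T,v) < 0` already makes the coordinate lines of
  `HonestCore` (d) and `Seamed` (5) future CAUSAL curves; the thresholds only re-prove timelikeness.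
* §3 `not_withoutFutureOrientation` — LOAD-BEARING, formal: the core with `HonestCore` (d) deleted (all
  other clauses verbatim) is FALSE (Minkowski, `N = 0`, time-reversed flat chart; landed as
  `Theorems/SeamedChartsExhaust/Negative/{ReversedFlatChart,WithoutFutureOrientation}.lean`).
* §4 `line_mem_causalFuture`, `line_mem_chronologicalFuture` (cycle 2: timelike variant) and
  `hasExhaustiveCharts_of_N_eq_zero` — coordinate lines through any smooth chart on an open `U ⊆ E4` along
  which `dΦ(v)` is future-directed (resp. also timelike) are causal (resp. timelike) curves; NO
  COUNTEREXAMPLE WITHOUT A HOLE (landed as `Negative/NoHoleCase.lean`).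
* §5 (cycle 2) THE EXACT SCHWARZSCHILD MODEL `SchwModel` — the first hole-bearing (`N = 1`) Lean model of
  the clause set: ambient spacetime the Kerr–Schild patch `Kerr.spacetime M 0 r₀` (`0 < r₀ ≤ 2M`;
  `[Kerr.Facts]` is inhabited, `kerrFacts`), `O = {r > 2M}`, motion `(1, 0)`, identity hole chart,
  identity flat chart on `U = {x⁰ > τ₀ − 1, r > ρ(x⁰)}`, `ρ(t) = R₀ + 1 + √t`, `R(s) = R₀ + 4 + √s`,
  `τ₀ = 0`; `decomp` discharges every field of `FinalStateDecomposition` (flat `C²` convergence by the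
  tree's `tendsto_deviationCk_backgroundOn`, covering clause by the static flow). Results:
  - `KerrTime.time_monotoneOn` / `time_le_of_mem_causalPast`: Kerr–Schild time `x⁰` is a TIME FUNCTION
    on every patch `{r > max r₀ 0}`, all `M ≥ 0`, all `a` (`g(V, v) = −v⁰`); `Schw.vertical_mem_*`:
    the static flow `∂₀` is future timelike on `{r > 2M}`.
  - `SchwModel.honestCore_decomp`, `seamed_decomp`, `hasExhaustiveCharts_decomp`, `O_eq_core`, packaged as
    `exists_N_one_honest_seamed_exhaustive`: NON-VACUITY WITH A HOLE — the `O`-shape, `HonestCore`, all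
    twelve `Seamed` clauses AND the conclusion hold simultaneously for `N = 1` (exterior patch `r₀ = 2M`).
  - `not_frontierBelowSlabAbs`: the registered stub `stub_frontierBelowSlab` WITHOUT its `∩ O` is FALSE
    (horizon-penetrating patch `r₀ = M`: the future-horizon point `(2, 2M, 0, 0)` is a limit of certified
    tube points, is uncharted, and is not in `J⁻` of the slab `{x⁰ = 1}` by the time function). The
    `∩ O` and the relativisation of `HonestCore` (c) to `O` are therefore LOAD-BEARING for FRONTIER;
  - `not_absoluteTubeClosedness`: `HonestCore` (c) with "relatively closed in `O`" strengthened to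
    "closed" is incompatible with `HonestCore` itself once the ambient spacetime contains the horizon —
    the self-determined exterior `O`, not `𝓢`, is the right domain for every closure statement.
* §6 (cycle 2) `KerrTime.spatialNorm_le_abs_of_isCausal`, `exists_norm_spatial_sub_le_of_mem_causalPast`:
  Kerr–Schild cones lie inside the Minkowski cones for `M ≥ 0` (`‖v̲‖ ≤ |v⁰|`), so `p ∈ J⁻(S)` forces a
  `q ∈ S` with `‖q̲ − p̲‖ ≤ q⁰ − p⁰`; `not_firstContact_without_seamed8`: the LANDED stub `stub_firstContact`
  (p76467; hypotheses `hd`, `hR`, `h8`) is FALSE without `h8` = SEAMED (8) — model `SchwModel.P₁` (mass 1,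
  exterior patch, `R₀ = 100`), `R ≡ 0`, `τ₁ = 1/16`, `y = (1/64, ρ(1/64) + 1/16, 0, 0)`: the flat tube
  `ρ(t) = R₀ + 1 + √t` outruns light near `t = 0` (formalises drefute g3's paper witness; `hd` is formal
  since cycle 1). CORRECTION of the record on `hR` (continuity of `R`): drefute g3's paper drop-witness for
  `hR` (a step profile `R = 0` before the reach supremum `s*`) is INVALID — it violates `h8`, which is kept:
  `h8` quantifies over ALL coordinate points, so it forces `Rⱼ(s) ≥ ρⱼ(s) + 2` at every hole time `s ≥ τ₀`
  (take `y` on the tube wall). In the identity model this makes `hR` UNNECESSARY: along the vertical ray from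
  `y` (radius `r_y` fixed) a contact `r_y ≤ R(t)` occurs no later than the flat time `t₂` with
  `ρ(t₂) = r_y − 2`, strictly inside `U`, so RIGHT holds (or LEFT, if `t₂ > τ₁`) for every `R` allowed by
  `h8`, continuous or not — AS LONG AS `ρ` IS CONTINUOUS. The structure only asks `ρᵢ(t)/t → 0` and `U`
  open (i.e. `ρᵢ` upper semicontinuous), and with a JUMPING tube radius `hR` IS load-bearing: the tree's
  `Negative/JumpModel.lean` (another seat, built on §5's bookkeeping and `Negative/KerrSchildTimeFunction`)
  takes `ρ(t) = 101 + √t + 10·𝟙[1 ≤ t]`, `R = ρ + 2` (so (8) holds and `R` jumps at hole time `1`) and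
  `y = (1/4, 105.5, 0, 0)`: the vertical ray exits `U` at flat time `1` before any contact (`R ≤ 104 < 105.5`
  for `t < 1`) and the flat slab `{x⁰ = 1, r > 112}` is out of light's reach.
* STATUS at 06:00Z: the crux is PROVED in the tree — `Theorems/StarvedNecksSeamedChartsExhaust.lean`
  (`seamedChartsExhaust`, line `wide-anchoring` g2; clause ledger "as predicted by the standing disprover's
  analysis": sub-extremality and SEAMED (3), (4) unused).

## Stubs of the picked line — both TRUE, and (03:05Z) both LANDED

Generation 2 of `Lines/wide-anchoring.lean` registers `stub_firstContact` (the flat `e₀`-ray up to FIRST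
CONTACT with the closed certified tubes; hypotheses `hd` = (d), `hR` = continuity of `R`, `h8` = (8)) and
`stub_rim` (closure enumeration; `hcl` = (c), `h1`, `h8`, `h11`), both stated over tree declarations only;
they are landed as `Theorems/StarvedNecksSeamedChartsExhaustStub{FirstContact,Rim}.lean` (p76467, p76185)
and the crux closes from them through the registered assembly (drefute g3). Load-bearing hypotheses of
`stub_firstContact`: `hd` (cycle 1, formal), `h8` (§6, formal: `not_firstContact_without_seamed8`); `hR` is
NOT load-bearing in the identity model (§6 bullet: drefute g3's step-profile witness violates `h8`). The cycle-2 paper verification of the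
generation-1 stubs (same mathematics, fatter statements) is kept for the record:

`stub_flatBoarding` (BOARD, arbitrary `O`): contact set `C = {σ ∈ [0, τ₁ − y⁰] | ∃ k, rₖ ≤ Rₖ(tₖ)}` along
the `e₀`-ray is closed (`Kerr.continuous_radius`, `continuous_poincareInv`, `Seamed` (1)); `C = ∅` ⇒ the
ray stays in `d.flatDomain` by the CONTRAPOSITIVE of (8) (`rⱼ > Rⱼ(tⱼ) ⇒ ρⱼ(x⁰) < rⱼ`) and the structure
field `setOf_lt_excision_subset_flatDomain`, reaching the flat slab; else at `u = min C`: `y_u ∈ flatDomain`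
(`u > 0`: limits give `rⱼ(y_u) ≥ Rⱼ(tⱼ y_u)` for all `j`, then (8)-contrapositive; `u = 0`: (7)); ONE ATLAS
(6) at `y_u` (hole domain: `r > ρ ≥ R₀ ≥ 100M > r₊`); (9) gives `tₖ(y_u) ≤ y_u⁰ ≤ τ₁`; ride `Λₖe₀` with (5)
(flat-late disjunct `τ₀ ≤ x⁰`, radius fixed, `R` monotone, `(Λe₀)⁰ > 0`) to the hole disc; compose with
`causalFuture_causalFuture_eq`. Uses `HonestCore` (a) (only `r₊ < R₀`, orthochronous), (d); `Seamed` (1),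
(5), (6), (7), (8), (9). `Seamed` (12) is NOT needed. `stub_frontierBelowSlab` (FRONTIER): `closure` of a
finite union; flat part through (11) (`y⁰ > τ₁` ⇒ in `F`; `= τ₁` ⇒ slab; wall `Ψⱼ x`, `x⁰ ≥ τ₁`,
`rⱼ = ρⱼ(x⁰) ≥ R₀`: (8) ⇒ `rⱼ + 2 ≤ Rⱼ(tⱼ x)`; `tⱼ x > τ₁` ⇒ in `Fⱼ`, contradiction; `= τ₁` ⇒ slab; `< τ₁` ⇒
ride); hole part through `HonestCore` (c) with `ϱ = Rⱼ`: `t = τ₁` ⇒ slab, `t > τ₁` ⇒ in `Fⱼ`, contradiction.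
NO LATERAL-WALL CASE ARISES (the hole part of `certifiedLate` is laterally closed, `r ≤ R(t)`), so FRONTIER
is simpler than the line card says; `not_frontierBelowSlabAbs` shows its `∩ O` cannot be dropped.

## Why no further clause could be shown load-bearing with exact models (cycle 2, "static immunity")

In exact Schwarzschild with honest (inclusion) charts on `{r ≥ R₀}` and ANY deep (`r < R₀`) or far-leaf
modification of the hole chart: `x⁰` is a time function and `∂₀` a future timelike flow preserving `r`, so
exhaustion fails at `p` iff no point of `certifiedSlab τ₁` lies vertically above `p` — impossible when the
hole leaves `Ψ({s} × ·)` are graphs over the whole exterior. Non-surjective deep charts (a receding sleeve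
or a wobbling crescent at the horizon) DO break exhaustion but also break the STRUCTURE's own covering clause
(`diff_subset_causalPast`: a late uncharted pocket is not below the initial slabs) unless the leaves bend in
time, and with anchoring (b) kept, bent spherically-symmetric leaf families must cross (IVT in the `(x⁰, r)`
half-plane): a model refuting the core minus (c) alone would need a twisted (non-axisymmetric) hole
foliation. Advanced hole clocks (¬(9)) realised by `c = −T e₀` break (10) near `τ₀`; realised by a boost
(`R(t*)` above the linear cap `((γ−1)t* + c⁰)/(γv) − 2` of cycle 1) they keep (10) after re-timing the far
leaves, but exhaustion still HOLDS by the static flow. The `N = 0` attack on (11) needs a flat chart whose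
late slabs are near-isometric yet NOT properly embedded; worldlines have linearly growing ambient time
(`Φ^*g(e₀,e₀) ≈ −1`), so only exotic non-proper complete spacelike slabs could serve — not pursued.
Net: (d) remains the only clause formally shown load-bearing; (b), (c), (6), (8), (9), (10), (11) protect
the PROOF METHOD against dynamical geometry / dishonest deep charts and are consumed where the paper proof
says (clause ledger below).

## Remarks for the provers of `NecksCertify` (producers of `(d₂, R, R₀')`), from building the model

* `Seamed` (6) and (7) are keyed on COORDINATE time `y⁰ ≥ τ₀` (not `>`): the collar points with `y⁰ = τ₀`
  must lie in `d₂.flatDomain`, so the flat domain must extend slightly BELOW `τ₀` (the model uses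
  `{x⁰ > τ₀ − 1, r > ρ(x⁰)}`; the DHRT-style domain `{x⁰ > τ₀, r > ρ}` violates (6)).
* One atlas (6) plus both convergences force `ρᵢ(τ) → ∞`: on the overlap shell `{ρᵢ(τ) < rᵢ ≤ Rᵢ(τ) + 1}`
  the same map converges to Kerr and to `η`, so `sup |g_Kerr − η| ~ 2Mᵢ/ρᵢ(τ) → 0`.
* `Seamed` (3) needs `R₀` beyond the (non-explicit) threshold of `Kerr.norm_iteratedFDeriv_ksPert_le M a 0`
  (`exists_tail_tenth`); `100 M ≤ R₀` alone is not what makes `‖g − η‖ ≤ 1/10` available in the tree.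

## The proof plan, verified clause by clause (cycle 1; for the provers)

Notation: `Φ` flat chart on `U = d.flatDomain`, `Ψᵢ` hole charts, `t*ᵢ, rᵢ` rest-frame Kerr–Schild time
and radius of hole `i` (functions on `E4`), `x⁰` the flat time, `ρᵢ` flat tube radii, `CL(τ₁) =
certifiedLate d R τ₁`, `CS(τ₁) = certifiedSlab d R τ₁`, `p ≤ q` / `p ≪ q` causal / chronological order.
(α) REACH. `p ∈ O ⊆ I⁻(charted)` gives `p ≪ q`, `q` flat-late or hole-late (NEVER an early chart leaf:
this is the only use of `O = exteriorOf`). Flat-late `q = Φ(y)`, `y⁰ > τ₀`: the `e₀`-line `s ↦ Φ(y + s e₀)`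
is future causal while in `U` ((d)); `U ∩ {x⁰ > τ₀} = {x⁰ > τ₀} ∩ ⋂ⱼ {rⱼ > ρⱼ(x⁰)}` (structure field +
(7)), so the line either reaches `x⁰ = τ₁` (a point of `CS`) or `x⁰ > τ₁` already (then `q ∈ CL`, go to
(β)), or first leaves `U` at `e = y + σ₁e₀` with `rⱼ(e) ≤ ρⱼ(e⁰)` for some `j`, `rⱼ(e) ≥ R₀ > r₊`
(continuity, (1)), hence `rⱼ(e) + 2 ≤ Rⱼ(t*ⱼ e)` ((8)). SWITCH SLIGHTLY BEFORE THE EXIT (or, as the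
picked line does, at FIRST CONTACT with `⋃ₖ{rₖ ≤ Rₖ(tₖ)}`): ONE ATLAS (6) gives `Φ(y') = Ψⱼ(y')`; from
`y'` the `Λⱼe₀`-line keeps `rⱼ` fixed, raises `t*ⱼ` and `x⁰` ((a) orthochronous), stays in the region of
(5), hence is future causal and lands on the hole disc `{t*ⱼ = τ₁, rⱼ ≤ Rⱼ(τ₁)} ⊆ CS` ((9): `t*ⱼ(y') ≤ τ₁`).
Hole-late `q = Ψᵢ(x)`, `t*ᵢ(x) < τ₁`: ANCHORING (b) with `ϱ = max(R₀, rᵢ x + 1)`, `τ₂ = τ₁`; collar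
(`(9),(8),(12) ⇒ (6)`) and far leaves ((10)) are flat-late. Corners: concatenations are not causal curves
in the tree's API; use `causalFuture_causalFuture_eq` and `I⁺ ⊆ J⁺`.
(β) FIRST ENTRY. If the chain ends at `q' ∈ CL(τ₁)`: first parameter of a causal curve from `p` in
`closure CL`; that point `z` is in `O` (`z ∈ J⁺(p) ⊆ J⁺(Σ)`, `z ≤ q' ≪ q''` charted, push-up) and, by
FRONTIER, in `CS ∪ J⁻(CS)`; horizon-side limits are excluded by (c) — and `not_frontierBelowSlabAbs`
shows they really occur once `∩ O` is forgotten.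
Clause ledger: (a) orthochronous + `r₊ < R₀`; (b) hole-late deep points; (c) hole part of FRONTIER;
(d) flat flow; (1) margins/monotone/continuous; (2) conclusion (i); (5) rides; (6) seams; (7) exit/contact
characterisation; (8) contacts land deep inside certified tubes; (9) rides go UP to `τ₁`; (10) far leaves;
(11) flat part of FRONTIER; (12) one-atlas applicability for `N ≥ 2` in the hole routing. UNUSED:
sub-extremality, `100M ≤ R₀` beyond `r₊ < R₀`, (3), (4), separation/sublinearity/convergence fields (§2).

## For the provers: API needed

`causalFuture_causalFuture_eq` (transitivity), push-up (`CausalityPushUp`), `mem_causalPast_of_mem_causalFuture`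
/ `mem_chronologicalPast_of_mem_chronologicalFuture` (duality), `IsOpenEmbedding` of late restrictions,
`OpensChart.mfderiv_inclusion_apply` / `mfderiv_subtypeVal` (differentials of inclusions are the identity),
`line_mem_causalFuture` (clamp the parameter to get a curve differentiable on a CLOSED interval),
`IsClosed.sInf_mem`-type first-contact bookkeeping on `Icc`, `closure_minimal` + `IsClosed.preimage
continuous_subtype_val` for closures inside an open submanifold (§5 (c), (11)). When a concrete `Spacetime`
has carrier `↥(U : Opens E4)`, `rw` often fails the instances-transparency motive check ("argument has type
`↥U` but is expected to have type `𝓢.carrier`"): rewrite through `congrArg (fun w ↦ IsFutureDirected (x := z) w)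
e |>.mpr` or restate with `show`/`change` (§5 does this throughout).
-/

noncomputable section

open TopologicalSpace Manifold Filter Topology Set Function
open scoped ContDiff Topology ENNReal Manifold

set_option linter.dupNamespace false

-- instance search through nested operator types `E4 →L E4 →L E4 →L ℝ` (as in the tree files)
set_option maxSynthPendingDepth 3

namespace Summit.FinalStateConjecture.FinalStateConjecture.Cruxes.SeamedChartsExhaust.Disproof

open Literature.Geometry.Lorentzian LorentzianMetric
open Summit.FinalStateConjecture.FinalStateConjecture.Theses.StarvedNecks (SeamedChartsExhaust)

/-! ## §1 Read-back: the two let-bound predicates of the crux, named -/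

/-- `HonestCore 𝓢 O k d R₀` — verbatim the let-bound predicate `Hc` of the route file
`Theses/StarvedNecks.lean` (items `NecksCertify`, `HonestFixedRadiusSettling`, `SeamedChartsExhaust`):
(a) sub-extremal holes, `100 Mᵢ ≤ R₀`, orthochronous boosts `(Λᵢ e₀)⁰ > 0`; (b) ANCHORING: hole-late
points of `{r < ϱ}` before hole time `τ₂` lie in `J⁻` of the hole disc `{t*ᵢ = τ₂, rᵢ ≤ ϱ}` (`ϱ ≥ R₀`);
(c) RELATIVE CLOSEDNESS in `O` of every late tube portion `{τ' ≤ t*ᵢ, rᵢ ≤ ϱ(t*ᵢ)}` (`ϱ` continuous);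
(d) the flat chart is future oriented: `dΦ(e₀)` future-directed causal at flat-late points. [folklore] -/
def HonestCore (𝓢 : Spacetime.{0} 4) (O : Set 𝓢.carrier) (k : ℕ) (d : FinalStateDecomposition 𝓢 O k)
    (R₀ : ℝ) : Prop :=
  let B := d.background; let t := fun i ↦ (B i).time; let r := fun i ↦ (B i).radius; let Ψ := d.chart;
  (∀ i, Kerr.IsSubextremal (d.mass i) (d.spin i) ∧ 100 * d.mass i ≤ R₀ ∧
    0 < ((d.motion i).1 : E4 ≃L[ℝ] E4) (E4.basisVector 0) 0) ∧
  (∀ i (ϱ τ₂ : ℝ), R₀ ≤ ϱ → d.τ₀ < τ₂ →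
    Ψ i '' {x | d.τ₀ < t i x.1 ∧ t i x.1 < τ₂ ∧ r i x.1 < ϱ} ⊆
      𝓢.metric.causalPast 𝓢.timeOrientation (Ψ i '' (B i).truncTimeSlab ϱ τ₂)) ∧
  (∀ i (τ' : ℝ) (ϱ : ℝ → ℝ), Continuous ϱ → d.τ₀ < τ' →
    let A := Ψ i '' {x | τ' ≤ t i x.1 ∧ r i x.1 ≤ ϱ (t i x.1)}; closure A ∩ O ⊆ A) ∧
  (∀ y : d.flatDomain, d.τ₀ < y.1 0 →
    𝓢.timeOrientation.IsFutureDirected (mfderiv 𝓘(ℝ, E4) (𝓡 4) d.flatChart y (E4.basisVector 0)))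

/-- `Seamed 𝓢 O d R R₀` — verbatim the let-bound predicate `Sm` (SEAMED) of the route file, twelve
conjuncts: (1) `Rᵢ` monotone, continuous, `≥ R₀ + 4`, flat tubes `ρᵢ ≥ R₀`; (2) `C²` certification of
hole `i` out to `Rᵢ(τ)`; (3) flat `C⁰` threshold `1/10` from `τ₀`; (4) hole `C⁰` threshold
`1/(10‖Λᵢ‖²)` on certified tubes `R₀ ≤ rᵢ ≤ Rᵢ(t*ᵢ)` (hole-late or flat-late); (5) `dΨᵢ(Λᵢ e₀)` future
directed there; (6) ONE ATLAS on collars; (7) flat-late domain = tube complement; (8) flat tubes deep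
(margin 2) inside certified tubes; (9) clock lag `t*ᵢ ≤ x⁰` on certified tubes `+2`; (10) far hole
leaves inside the radiation zone; (11) closures of flat-late closed slabs = flat points ∪ hole-charted
tube walls; (12) certified tubes `+1` of different holes disjoint in coordinates. [folklore] -/
def Seamed (𝓢 : Spacetime.{0} 4) (O : Set 𝓢.carrier) (d : FinalStateDecomposition 𝓢 O 2)
    (R : Fin d.N → ℝ → ℝ) (R₀ : ℝ) : Prop :=
  let B := d.background; let t := fun i ↦ (B i).time; let r := fun i ↦ (B i).radius;
  let Λ := fun i ↦ ((d.motion i).1 : E4 ≃L[ℝ] E4); let Φ := d.flatChart; let Ψ := d.chart;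
  let ρ := d.excision;
  (∀ i, Monotone (R i) ∧ Continuous (R i) ∧ ∀ s, R₀ + 4 ≤ R i s ∧ R₀ ≤ ρ i s) ∧
  (∀ i, Tendsto (fun τ ↦ 𝓢.truncDeviationCk (B i) (Ψ i) 2 (R i τ) τ) atTop (𝓝 0)) ∧
  supCkENorm (Subtype.val '' {y : d.flatDomain | d.τ₀ ≤ y.1 0}) 0
      (𝓢.deviationExtend (Minkowski.backgroundOn d.flatDomain) Φ) ≤ 10⁻¹ ∧
  (∀ i, supCkENorm (Subtype.val '' {x : (B i).domain | (d.τ₀ ≤ t i x.1 ∨ d.τ₀ ≤ x.1 0) ∧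
      R₀ ≤ r i x.1 ∧ r i x.1 ≤ R i (t i x.1)}) 0 (𝓢.deviationExtend (B i) (Ψ i)) ≤
      ENNReal.ofReal (1 / (10 * ‖(Λ i : E4 →L[ℝ] E4)‖ ^ 2))) ∧
  (∀ i (x : (B i).domain), (d.τ₀ ≤ t i x.1 ∨ d.τ₀ ≤ x.1 0) → R₀ ≤ r i x.1 → r i x.1 ≤ R i (t i x.1) →
    𝓢.timeOrientation.IsFutureDirected (mfderiv 𝓘(ℝ, E4) (𝓡 4) (Ψ i) x ((Λ i) (E4.basisVector 0)))) ∧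
  (∀ i (y : E4) (hy : y ∈ (B i).domain), d.τ₀ ≤ y 0 → (∀ j, ρ j (y 0) < r j y) →
    r i y ≤ R i (t i y) + 1 → ∃ hy' : y ∈ d.flatDomain, Ψ i ⟨y, hy⟩ = Φ ⟨y, hy'⟩) ∧
  (∀ y : d.flatDomain, d.τ₀ ≤ y.1 0 → ∀ j, ρ j (y.1 0) < r j y.1) ∧
  (∀ j (y : E4), d.τ₀ ≤ y 0 → r j y ≤ ρ j (y 0) → r j y + 2 ≤ R j (t j y)) ∧
  (∀ j (y : E4), d.τ₀ ≤ t j y → r j y ≤ R j (t j y) + 2 → t j y ≤ y 0) ∧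
  (∀ j, Ψ j '' {x | d.τ₀ < t j x.1 ∧ R j (t j x.1) + 1 < r j x.1} ⊆ d.radiationZone) ∧
  (∀ τ' : ℝ, d.τ₀ < τ' → closure (Φ '' {y | τ' ≤ y.1 0}) ⊆
    Φ '' {y | τ' ≤ y.1 0} ∪ ⋃ j, Ψ j '' {x | τ' ≤ x.1 0 ∧ r j x.1 = ρ j (x.1 0)}) ∧
  (∀ j j' (y : E4), j ≠ j' → (d.τ₀ ≤ y 0 ∨ d.τ₀ ≤ t j y) → r j y ≤ R j (t j y) + 1 →
    R j' (t j' y) + 1 < r j' y)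

/-- READ-BACK (`Iff.rfl`): the crux `SeamedChartsExhaust` says, for EVERY admissible datum `D` on a
connected `3`-manifold `X`, every maximal vacuum Cauchy development `𝒟` of `D`, every region `O`, every
`C²` final-state decomposition `d` of `O`, all radii `R : Fin d.N → ℝ → ℝ` and `R₀ : ℝ`:
`O = J⁺(ι X) ∩ I⁻(d.charted)` and `HonestCore(d, R₀)` and `Seamed(d, R, R₀)` imply
`HasExhaustiveCharts d` (whose radii are existential; the given `R` serve). [folklore] -/
theorem seamedChartsExhaust_iff :
    SeamedChartsExhaust ↔
      ∀ (X : Type) [TopologicalSpace X] [ChartedSpace E3 X] [IsManifold (𝓡 3) ∞ X] [ConnectedSpace X]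
        (D : InitialDataSet (𝓡 3) X), D ∈ admissibleVacuumData X →
        ∀ 𝒟 : VacuumCauchyDevelopment D, 𝒟.IsMaximal →
        ∀ (O : Set 𝒟.carrier) (d : FinalStateDecomposition 𝒟.toSpacetime O 2) (R : Fin d.N → ℝ → ℝ)
          (R₀ : ℝ), O = exteriorOf 𝒟.toCauchyDevelopment d.charted →
          HonestCore 𝒟.toSpacetime O 2 d R₀ → Seamed 𝒟.toSpacetime O d R R₀ → HasExhaustiveCharts d :=
  Iff.rfl


/-! ## §2 The spacetime-level core with the decorative hypotheses removed

The proof plan (α)/(β) (module docstring) never uses: that `𝒟` is vacuum, maximal, or a development of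
admissible data (only the SHAPE `O = J⁺(Σ) ∩ I⁻(d.charted)` of the self-determined exterior, for an
arbitrary set `Σ`); sub-extremality `|aᵢ| < Mᵢ` and `100 Mᵢ ≤ R₀` beyond `r₊(Mᵢ, aᵢ) < R₀`; the two `C⁰`
thresholds SEAMED (3), (4) (because `TimeOrientation.IsFutureDirected v` is DEFINED as
`IsCausal v ∧ g(T, v) < 0`, clauses `HonestCore` (d) and SEAMED (5) already make the `e₀`- and
`Λᵢe₀`-coordinate lines future causal curves). `SeamedChartsExhaustCore` is the crux with exactly these
deletions; `seamedChartsExhaust_of_core` is the (trivial) reduction. Provers may aim at the core. -/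

/-- The clauses of `HonestCore` that the exhaustion argument uses: (a') `r₊(Mᵢ,aᵢ) < R₀` and
orthochronous boosts; (b) anchoring; (c) relative closedness; (d) future-oriented flat chart. [folklore] -/
def CoreHonest (𝓢 : Spacetime.{0} 4) (O : Set 𝓢.carrier) (k : ℕ) (d : FinalStateDecomposition 𝓢 O k)
    (R₀ : ℝ) : Prop :=
  let B := d.background; let t := fun i ↦ (B i).time; let r := fun i ↦ (B i).radius; let Ψ := d.chart;
  (∀ i, Kerr.rPlus (d.mass i) (d.spin i) < R₀ ∧ 0 < ((d.motion i).1 : E4 ≃L[ℝ] E4) (E4.basisVector 0) 0) ∧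
  (∀ i (ϱ τ₂ : ℝ), R₀ ≤ ϱ → d.τ₀ < τ₂ →
    Ψ i '' {x | d.τ₀ < t i x.1 ∧ t i x.1 < τ₂ ∧ r i x.1 < ϱ} ⊆
      𝓢.metric.causalPast 𝓢.timeOrientation (Ψ i '' (B i).truncTimeSlab ϱ τ₂)) ∧
  (∀ i (τ' : ℝ) (ϱ : ℝ → ℝ), Continuous ϱ → d.τ₀ < τ' →
    let A := Ψ i '' {x | τ' ≤ t i x.1 ∧ r i x.1 ≤ ϱ (t i x.1)}; closure A ∩ O ⊆ A) ∧
  (∀ y : d.flatDomain, d.τ₀ < y.1 0 →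
    𝓢.timeOrientation.IsFutureDirected (mfderiv 𝓘(ℝ, E4) (𝓡 4) d.flatChart y (E4.basisVector 0)))

/-- The clauses of `Seamed` that the exhaustion argument uses: all but the two `C⁰` thresholds (3), (4).
[folklore] -/
def CoreSeamed (𝓢 : Spacetime.{0} 4) (O : Set 𝓢.carrier) (d : FinalStateDecomposition 𝓢 O 2)
    (R : Fin d.N → ℝ → ℝ) (R₀ : ℝ) : Prop :=
  let B := d.background; let t := fun i ↦ (B i).time; let r := fun i ↦ (B i).radius;
  let Λ := fun i ↦ ((d.motion i).1 : E4 ≃L[ℝ] E4); let Φ := d.flatChart; let Ψ := d.chart;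
  let ρ := d.excision;
  (∀ i, Monotone (R i) ∧ Continuous (R i) ∧ ∀ s, R₀ + 4 ≤ R i s ∧ R₀ ≤ ρ i s) ∧
  (∀ i, Tendsto (fun τ ↦ 𝓢.truncDeviationCk (B i) (Ψ i) 2 (R i τ) τ) atTop (𝓝 0)) ∧
  (∀ i (x : (B i).domain), (d.τ₀ ≤ t i x.1 ∨ d.τ₀ ≤ x.1 0) → R₀ ≤ r i x.1 → r i x.1 ≤ R i (t i x.1) →
    𝓢.timeOrientation.IsFutureDirected (mfderiv 𝓘(ℝ, E4) (𝓡 4) (Ψ i) x ((Λ i) (E4.basisVector 0)))) ∧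
  (∀ i (y : E4) (hy : y ∈ (B i).domain), d.τ₀ ≤ y 0 → (∀ j, ρ j (y 0) < r j y) →
    r i y ≤ R i (t i y) + 1 → ∃ hy' : y ∈ d.flatDomain, Ψ i ⟨y, hy⟩ = Φ ⟨y, hy'⟩) ∧
  (∀ y : d.flatDomain, d.τ₀ ≤ y.1 0 → ∀ j, ρ j (y.1 0) < r j y.1) ∧
  (∀ j (y : E4), d.τ₀ ≤ y 0 → r j y ≤ ρ j (y 0) → r j y + 2 ≤ R j (t j y)) ∧
  (∀ j (y : E4), d.τ₀ ≤ t j y → r j y ≤ R j (t j y) + 2 → t j y ≤ y 0) ∧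
  (∀ j, Ψ j '' {x | d.τ₀ < t j x.1 ∧ R j (t j x.1) + 1 < r j x.1} ⊆ d.radiationZone) ∧
  (∀ τ' : ℝ, d.τ₀ < τ' → closure (Φ '' {y | τ' ≤ y.1 0}) ⊆
    Φ '' {y | τ' ≤ y.1 0} ∪ ⋃ j, Ψ j '' {x | τ' ≤ x.1 0 ∧ r j x.1 = ρ j (x.1 0)}) ∧
  (∀ j j' (y : E4), j ≠ j' → (d.τ₀ ≤ y 0 ∨ d.τ₀ ≤ t j y) → r j y ≤ R j (t j y) + 1 →
    R j' (t j' y) + 1 < r j' y)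

/-- THE CORE of the crux, at the level of an arbitrary time-oriented spacetime `𝓢` and an arbitrary set
`Σ ⊆ 𝓢` in place of the data hypersurface: `O = J⁺(Σ) ∩ I⁻(d.charted)`, `CoreHonest`, `CoreSeamed`
imply `HasExhaustiveCharts d`. No field equation, maximality, admissibility, sub-extremality or `C⁰`
threshold enters. (Believed TRUE — this disprover found no counterexample; see the module docstring for
the verified proof plan and for which of the remaining clauses are load-bearing.) [folklore] -/
def SeamedChartsExhaustCore : Prop :=
  ∀ (𝓢 : Spacetime.{0} 4) (S₀ O : Set 𝓢.carrier) (d : FinalStateDecomposition 𝓢 O 2)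
    (R : Fin d.N → ℝ → ℝ) (R₀ : ℝ),
    O = 𝓢.metric.causalFuture 𝓢.timeOrientation S₀ ∩
      𝓢.metric.chronologicalPast 𝓢.timeOrientation d.charted →
    CoreHonest 𝓢 O 2 d R₀ → CoreSeamed 𝓢 O d R R₀ → HasExhaustiveCharts d

/-- `r₊(M, a) = M + √(M² − a²) ≤ 2M` for `0 ≤ M` (Kerr–Schild horizon radius; O'Neill 1995, §2.5).
[folklore] -/
theorem rPlus_le_two_mul {M : ℝ} (hM : 0 ≤ M) (a : ℝ) : Kerr.rPlus M a ≤ 2 * M := by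
  unfold Kerr.rPlus
  have h1 : √(M ^ 2 - a ^ 2) ≤ √(M ^ 2) := Real.sqrt_le_sqrt (by nlinarith [sq_nonneg a])
  rw [Real.sqrt_sq hM] at h1
  linarith

/-- `HonestCore` implies `CoreHonest`: `100 M ≤ R₀` and `0 < M` give `r₊ ≤ 2M < R₀`. [folklore] -/
theorem coreHonest_of_honestCore {𝓢 : Spacetime.{0} 4} {O : Set 𝓢.carrier} {k : ℕ}
    {d : FinalStateDecomposition 𝓢 O k} {R₀ : ℝ} (h : HonestCore 𝓢 O k d R₀) :
    CoreHonest 𝓢 O k d R₀ := by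
  obtain ⟨ha, hb, hc, hd⟩ := h
  refine ⟨fun i ↦ ⟨?_, (ha i).2.2⟩, hb, hc, hd⟩
  have hM := d.mass_pos i
  have := rPlus_le_two_mul hM.le (d.spin i)
  linarith [(ha i).2.1]

/-- `Seamed` implies `CoreSeamed` (drop conjuncts (3) and (4)). [folklore] -/
theorem coreSeamed_of_seamed {𝓢 : Spacetime.{0} 4} {O : Set 𝓢.carrier}
    {d : FinalStateDecomposition 𝓢 O 2} {R : Fin d.N → ℝ → ℝ} {R₀ : ℝ} (h : Seamed 𝓢 O d R R₀) :
    CoreSeamed 𝓢 O d R R₀ := by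
  obtain ⟨h1, h2, -, -, h5, h6, h7, h8, h9, h10, h11, h12⟩ := h
  exact ⟨h1, h2, h5, h6, h7, h8, h9, h10, h11, h12⟩

/-- REDUCTION: the core implies the crux (instantiate `𝓢 := 𝒟.toSpacetime`, `Σ := ι(X)`; the
self-determined exterior `exteriorOf 𝒟 d.charted` is `J⁺(ι X) ∩ I⁻(d.charted)` by definition).
Hence every hypothesis deleted in `SeamedChartsExhaustCore` is DECORATIVE for this item: vacuum,
maximality, admissibility, `Kerr.IsSubextremal`, `100 Mᵢ ≤ R₀` beyond `r₊ < R₀`, SEAMED (3), (4).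
[folklore] -/
theorem seamedChartsExhaust_of_core (h : SeamedChartsExhaustCore) : SeamedChartsExhaust := by
  intro X _ _ _ _ D _ 𝒟 _ O d R R₀ hO hc hs
  exact h 𝒟.toSpacetime (range 𝒟.embed) O d R R₀ hO (coreHonest_of_honestCore hc)
    (coreSeamed_of_seamed hs)


/-! ## §3 Load-bearing: the future-orientation clause `HonestCore` (d) cannot be dropped from the core

`WithoutFutureOrientation` is `SeamedChartsExhaustCore` with the FULL `HonestCore`/`Seamed` clauses
except `HonestCore` (d) (so it is weaker than "the crux minus (d)" only in that `Σ` and `𝓢` are free).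
It is FALSE (`not_withoutFutureOrientation`): Minkowski spacetime `(ℝ⁴, η, ∂ₜ)`, `Σ = ℝ⁴`,
`O = {x⁰ < 0} = J⁺(ℝ⁴) ∩ I⁻(charted)`, `N = 0`, flat domain `⊤`, flat chart the TIME REVERSAL
`x ↦ (−x⁰, x̲)` after `τ₀ = 0` (an exact anti-chronous isometry: every deviation vanishes, every SEAMED
clause holds, the flat-late closed slabs `{x⁰ ≤ −τ'}` are closed), and at `τ₁ = 1` the point
`p = (−1/2, 0)` is in `O`, outside `certifiedLate = {x⁰ < −1}` and NOT in `J⁻(certifiedSlab) =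
J⁻({x⁰ = −1}) = {x⁰ ≤ −1}`. Caveat recorded for provers: in the ROUTE's setting `Σ = ι(X)` is a Cauchy
hypersurface and `Seamed` (3) makes `dΦ(e₀)` timelike on the connected flat-late region, so a globally
time-reversed flat chart is excluded there (its `e₀`-lines would be past-directed timelike curves of
infinite length inside `J⁺(Σ)`); clause (d) is nevertheless the form in which the argument consumes
the time direction of the flat chart, and nothing else in `HonestCore`/`Seamed` provides it locally. -/

/-- `HonestCore` without its clause (d). [folklore] -/
def HonestCoreABC (𝓢 : Spacetime.{0} 4) (O : Set 𝓢.carrier) (k : ℕ) (d : FinalStateDecomposition 𝓢 O k)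
    (R₀ : ℝ) : Prop :=
  let B := d.background; let t := fun i ↦ (B i).time; let r := fun i ↦ (B i).radius; let Ψ := d.chart;
  (∀ i, Kerr.IsSubextremal (d.mass i) (d.spin i) ∧ 100 * d.mass i ≤ R₀ ∧
    0 < ((d.motion i).1 : E4 ≃L[ℝ] E4) (E4.basisVector 0) 0) ∧
  (∀ i (ϱ τ₂ : ℝ), R₀ ≤ ϱ → d.τ₀ < τ₂ →
    Ψ i '' {x | d.τ₀ < t i x.1 ∧ t i x.1 < τ₂ ∧ r i x.1 < ϱ} ⊆
      𝓢.metric.causalPast 𝓢.timeOrientation (Ψ i '' (B i).truncTimeSlab ϱ τ₂)) ∧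
  (∀ i (τ' : ℝ) (ϱ : ℝ → ℝ), Continuous ϱ → d.τ₀ < τ' →
    let A := Ψ i '' {x | τ' ≤ t i x.1 ∧ r i x.1 ≤ ϱ (t i x.1)}; closure A ∩ O ⊆ A)

/-- The crux at spacetime level with `HonestCore` (d) deleted (everything else verbatim). [folklore] -/
def WithoutFutureOrientation : Prop :=
  ∀ (𝓢 : Spacetime.{0} 4) (S₀ O : Set 𝓢.carrier) (d : FinalStateDecomposition 𝓢 O 2)
    (R : Fin d.N → ℝ → ℝ) (R₀ : ℝ),
    O = 𝓢.metric.causalFuture 𝓢.timeOrientation S₀ ∩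
      𝓢.metric.chronologicalPast 𝓢.timeOrientation d.charted →
    HonestCoreABC 𝓢 O 2 d R₀ → Seamed 𝓢 O d R R₀ → HasExhaustiveCharts d

namespace ReversedModel

/-- Time reversal `x ↦ (−x⁰, x̲)` of `E4`, as a continuous linear map. [folklore] -/
def T : E4 →L[ℝ] E4 :=
  ContinuousLinearMap.id ℝ E4 - (2 : ℝ) • (EuclideanSpace.proj (0 : Fin 4)).smulRight (E4.basisVector 0)

@[simp] theorem T_apply_zero (x : E4) : T x 0 = -x 0 := by
  simp [T]; ring

@[simp] theorem T_apply_succ (x : E4) (i : Fin 3) : T x i.succ = x i.succ := by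
  simp [T, Fin.succ_ne_zero]

theorem T_T (x : E4) : T (T x) = x := by
  ext i
  refine Fin.cases ?_ (fun j ↦ ?_) i
  · simp
  · simp

/-- `T` preserves the Minkowski form. [folklore] -/
theorem bilin_T (v w : E4) : Minkowski.bilin (T v) (T w) = Minkowski.bilin v w := by
  simp [Minkowski.bilin_apply]

theorem spatial_T (x : E4) : E4.spatial (T x) = E4.spatial x := by
  ext i
  simp [E4.spatial]

/-- `T` as a continuous linear equivalence (it is an involution). [folklore] -/
def Tequiv : E4 ≃L[ℝ] E4 := ContinuousLinearEquiv.equivOfInverse T T T_T T_T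

@[simp] theorem Tequiv_apply (x : E4) : Tequiv x = T x := rfl

/-- The reversed flat chart on the whole of `E4`. -/
def Φ : (⊤ : Opens E4) → E4 := fun y ↦ T y.1

theorem Φ_apply (y : (⊤ : Opens E4)) : Φ y = T y.1 := rfl

/-- The region: the open lower half-space `{x⁰ < 0}`. -/
def O : Set E4 := {x | x 0 < 0}

local notation "𝕄" => Minkowski.spacetime

theorem mfderiv_Φ_apply (y : (⊤ : Opens E4)) (v : E4) :
    mfderiv 𝓘(ℝ, E4) (𝓡 4) Φ y v = T v := by
  have h1 : mfderiv 𝓘(ℝ, E4) 𝓘(ℝ, E4) Φ y = mfderiv 𝓘(ℝ, E4) 𝓘(ℝ, E4) (⇑T) y.1 :=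
    mfderiv_comp_subtypeVal' (⇑T) y
  change mfderiv 𝓘(ℝ, E4) 𝓘(ℝ, E4) Φ y v = T v
  rw [h1, T.hasMFDerivAt.mfderiv]
  rfl

/-- The reversed chart is an exact isometry of `η`: its deviation vanishes. -/
theorem deviation_Φ (y : (⊤ : Opens E4)) :
    (𝕄).deviation (Minkowski.backgroundOn ⊤) Φ y = 0 := by
  ext v w
  change Minkowski.bilin (mfderiv 𝓘(ℝ, E4) (𝓡 4) Φ y v) (mfderiv 𝓘(ℝ, E4) (𝓡 4) Φ y w) -
    Minkowski.bilin v w = 0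
  rw [mfderiv_Φ_apply, mfderiv_Φ_apply, bilin_T, sub_self]

theorem deviationExtend_Φ : (𝕄).deviationExtend (Minkowski.backgroundOn ⊤) Φ = 0 := by
  funext y
  have := (𝕄).deviationExtend_coe (Minkowski.backgroundOn ⊤) Φ ⟨y, trivial⟩
  rw [deviation_Φ] at this
  exact this

theorem image_Φ_lateRegion (τ : ℝ) :
    Φ '' (Minkowski.backgroundOn ⊤).lateRegion τ = {x : E4 | x 0 < -τ} := by
  ext x
  constructor
  · rintro ⟨y, hy, rfl⟩
    have hy' : τ < y.1 0 := hy
    show T y.1 0 < -τ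
    rw [T_apply_zero]; linarith
  · intro hx
    refine ⟨⟨T x, trivial⟩, ?_, ?_⟩
    · show τ < T x 0
      rw [T_apply_zero]; have : x 0 < -τ := hx; linarith
    · show T (T x) = x
      exact T_T x

theorem image_Φ_timeSlab (τ : ℝ) :
    Φ '' (Minkowski.backgroundOn ⊤).timeSlab τ = {x : E4 | x 0 = -τ} := by
  ext x
  constructor
  · rintro ⟨y, hy, rfl⟩
    have hy' : y.1 0 = τ := hy
    show T y.1 0 = -τ
    rw [T_apply_zero, hy']
  · intro hx
    refine ⟨⟨T x, trivial⟩, ?_, ?_⟩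
    · show T x 0 = τ
      rw [T_apply_zero]; have : x 0 = -τ := hx; linarith
    · show T (T x) = x
      exact T_T x

theorem image_Φ_ge (τ : ℝ) :
    Φ '' {y : (⊤ : Opens E4) | τ ≤ y.1 0} = {x : E4 | x 0 ≤ -τ} := by
  ext x
  constructor
  · rintro ⟨y, hy, rfl⟩
    have hy' : τ ≤ y.1 0 := hy
    show T y.1 0 ≤ -τ
    rw [T_apply_zero]; linarith
  · intro hx
    refine ⟨⟨T x, trivial⟩, ?_, ?_⟩
    · show τ ≤ T x 0
      rw [T_apply_zero]; have : x 0 ≤ -τ := hx; linarith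
    · show T (T x) = x
      exact T_T x

/-- A point of the chronological past of a set is in the causal past of a point of the set. -/
theorem exists_mem_causalPast_singleton_of_mem_chronologicalPast {S : Set E4} {x : E4}
    (hx : x ∈ (𝕄).metric.chronologicalPast (𝕄).timeOrientation S) :
    ∃ q ∈ S, x ∈ (𝕄).metric.causalPast (𝕄).timeOrientation {q} := by
  obtain ⟨q, hq, γ, a, b, hab, hγ, hγa, hγb⟩ := hx
  exact ⟨q, hq, Or.inr ⟨q, rfl, γ, a, b, hab, hγ.isFutureCausalCurveOn, hγa, hγb⟩⟩

theorem exists_mem_causalPast_singleton_of_mem_causalPast {S : Set E4} {x : E4}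
    (hx : x ∈ (𝕄).metric.causalPast (𝕄).timeOrientation S) :
    ∃ q ∈ S, x ∈ (𝕄).metric.causalPast (𝕄).timeOrientation {q} := by
  rcases hx with hx | ⟨q, hq, γ, a, b, hab, hγ, hγa, hγb⟩
  · exact ⟨x, hx, Or.inl rfl⟩
  · exact ⟨q, hq, Or.inr ⟨q, rfl, γ, a, b, hab, hγ, hγa, hγb⟩⟩

theorem time_le_of_mem_causalPast_singleton {q x : E4}
    (h : x ∈ (𝕄).metric.causalPast (𝕄).timeOrientation {q}) : x 0 ≤ q 0 := by
  have h' : x ∈ {y : E4 | ‖E4.spatial q - E4.spatial y‖ ≤ q 0 - y 0} := by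
    rw [← Minkowski.causalPast_singleton q]; exact h
  have := h'
  simp only [mem_setOf_eq] at this
  linarith [norm_nonneg (E4.spatial q - E4.spatial x)]

/-- The vertical segment: `x ≪ x + s e₀` for `s > 0` in Minkowski spacetime. -/
theorem mem_chronologicalFuture_add_smul {x : E4} {s : ℝ} (hs : 0 < s) :
    x + s • E4.basisVector 0 ∈ (𝕄).metric.chronologicalFuture (𝕄).timeOrientation {x} := by
  refine ⟨x, rfl, fun σ : ℝ ↦ x + σ • (s • E4.basisVector 0), 0, 1, zero_lt_one, ?_, by simp, by simp⟩
  intro σ _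
  set v : E4 := s • E4.basisVector 0 with hv_def
  have hγ : HasDerivAt (fun σ : ℝ ↦ x + σ • v) v σ := by
    simpa using ((hasDerivAt_id σ).smul_const v).const_add x
  have hmd : MDifferentiableAt 𝓘(ℝ, ℝ) 𝓘(ℝ, E4) (fun σ : ℝ ↦ x + σ • v) σ :=
    mdifferentiableAt_iff_differentiableAt.mpr hγ.differentiableAt
  have hvel : velocity 𝓘(ℝ, E4) (fun σ : ℝ ↦ x + σ • v) σ = v := by
    unfold velocity
    rw [mfderiv_eq_fderiv]
    change fderiv ℝ (fun σ : ℝ ↦ x + σ • v) σ 1 = v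
    rw [hγ.hasFDerivAt.fderiv]
    simp
  have hvv : Minkowski.bilin v v = -s ^ 2 := by
    rw [hv_def, Minkowski.bilin_apply]
    simp [Fin.succ_ne_zero]; ring
  have hv0 : Minkowski.bilin (E4.basisVector 0) v = -s := by
    rw [Minkowski.bilin_basisVector_zero_left, hv_def]
    simp
  refine ⟨hmd, ?_, ⟨?_, ?_⟩, ?_⟩
  · change Minkowski.bilin (velocity 𝓘(ℝ, E4) (fun σ : ℝ ↦ x + σ • v) σ)
      (velocity 𝓘(ℝ, E4) (fun σ : ℝ ↦ x + σ • v) σ) < 0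
    rw [hvel, hvv]; nlinarith
  · change Minkowski.bilin (velocity 𝓘(ℝ, E4) (fun σ : ℝ ↦ x + σ • v) σ)
      (velocity 𝓘(ℝ, E4) (fun σ : ℝ ↦ x + σ • v) σ) ≤ 0
    rw [hvel, hvv]; nlinarith
  · change velocity 𝓘(ℝ, E4) (fun σ : ℝ ↦ x + σ • v) σ ≠ 0
    rw [hvel]
    intro h0
    have := congrArg (fun z : E4 ↦ z 0) h0
    simp [hv_def] at this
    exact hs.ne' this
  · change Minkowski.bilin (E4.basisVector 0) (velocity 𝓘(ℝ, E4) (fun σ : ℝ ↦ x + σ • v) σ) < 0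
    rw [hvel, hv0]; linarith

/-- `I⁻({x⁰ < 0}) = {x⁰ < 0}` in Minkowski spacetime. -/
theorem chronologicalPast_O :
    (𝕄).metric.chronologicalPast (𝕄).timeOrientation O = O := by
  refine Set.ext fun (x : E4) ↦ ⟨fun hx ↦ ?_, fun hx ↦ ?_⟩
  · obtain ⟨q, hq, hxq⟩ := exists_mem_causalPast_singleton_of_mem_chronologicalPast hx
    have := time_le_of_mem_causalPast_singleton hxq
    have hq' : q 0 < 0 := hq
    show x 0 < 0
    linarith
  · have hx' : x 0 < 0 := hx
    have hs : 0 < -(x 0) / 2 := by linarith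
    have hmem : x + (-(x 0) / 2) • E4.basisVector 0 ∈ O := by
      show (x + (-(x 0) / 2) • E4.basisVector 0) 0 < 0
      simp; linarith
    have h1 : x ∈ (𝕄).metric.chronologicalPast (𝕄).timeOrientation
        {x + (-(x 0) / 2) • E4.basisVector 0} :=
      mem_chronologicalPast_of_mem_chronologicalFuture (M := (𝕄).carrier)
        (mem_chronologicalFuture_add_smul hs)
    show x ∈ (𝕄).metric.chronologicalFuture (𝕄).timeOrientation.reverse O
    exact chronologicalFuture_mono (M := (𝕄).carrier) (singleton_subset_iff.mpr hmem) h1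

/-- The reversed chart is a late-time chart into `O` after `τ₀ = 0`. -/
theorem isLateChart_Φ : (𝕄).IsLateChart (Minkowski.backgroundOn ⊤) O 0 Φ := by
  refine ⟨?_, ?_, ?_⟩
  · exact T.contDiff.contMDiff.comp contMDiff_subtype_val
  · have hlate : IsOpen ((Minkowski.backgroundOn ⊤).lateRegion 0) :=
      isOpen_lt continuous_const ((PiLp.continuous_apply 2 _ 0).comp continuous_subtype_val)
    exact Tequiv.toHomeomorph.isOpenEmbedding.comp
      ((IsOpen.isOpenEmbedding_subtypeVal (⊤ : Opens E4).isOpen).comp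
        (IsOpen.isOpenEmbedding_subtypeVal hlate))
  · intro (x : E4) hx
    have hx' : x ∈ (Φ '' (Minkowski.backgroundOn ⊤).lateRegion 0 : Set E4) := hx
    rw [image_Φ_lateRegion] at hx'
    have : x 0 < -0 := hx'
    show x 0 < 0
    simpa using this

/-- The `N = 0` decomposition of `O = {x⁰ < 0} ⊆ ℝ⁴` by the time-reversed flat chart. -/
def decomp : FinalStateDecomposition 𝕄 O 2 where
  N := 0
  mass := Fin.elim0
  spin := Fin.elim0
  mass_pos i := i.elim0
  abs_spin_le_mass i := i.elim0
  motion := Fin.elim0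
  τ₀ := 0
  chart i := i.elim0
  isLateChart i := i.elim0
  tendsto_truncDeviationCk i := i.elim0
  exists_pairwise_disjoint _ := ⟨0, fun i ↦ i.elim0⟩
  excision := Fin.elim0
  tendsto_excision_div i := i.elim0
  flatDomain := ⊤
  setOf_lt_excision_subset_flatDomain _ _ := trivial
  flatChart := Φ
  isLateChart_flat := isLateChart_Φ
  tendsto_deviationCk_flat := by
    have h : ∀ τ, (𝕄).deviationCk (Minkowski.backgroundOn ⊤) Φ 2 τ = 0 := fun τ ↦ by
      rw [Spacetime.deviationCk, deviationExtend_Φ, supCkENorm_zero]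
    simp_rw [h]
    exact tendsto_const_nhds
  diff_subset_causalPast := by
    intro (x : E4) hx
    exfalso
    apply hx.2
    refine Or.inr ?_
    have hx1 : x 0 < 0 := hx.1
    have : x ∈ (Φ '' (Minkowski.backgroundOn ⊤).lateRegion 0 : Set E4) := by
      rw [image_Φ_lateRegion]
      show x 0 < -0
      simpa using hx1
    exact this

theorem decomp_N : decomp.N = 0 := rfl
theorem decomp_τ₀ : decomp.τ₀ = 0 := rfl
theorem decomp_flatDomain : decomp.flatDomain = ⊤ := rfl
theorem decomp_flatChart : decomp.flatChart = Φ := rfl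

instance : IsEmpty (Fin decomp.N) := Fin.isEmpty'

theorem charted_decomp : decomp.charted = O := by
  rw [FinalStateDecomposition.charted, iUnion_of_empty, union_empty,
    FinalStateDecomposition.radiationZone, decomp_flatChart, decomp_τ₀]
  show (Φ '' (Minkowski.backgroundOn ⊤).lateRegion 0 : Set E4) = O
  rw [image_Φ_lateRegion]
  ext x
  show x 0 < -0 ↔ x 0 < 0
  simp

theorem O_eq : O = (𝕄).metric.causalFuture (𝕄).timeOrientation univ ∩
    (𝕄).metric.chronologicalPast (𝕄).timeOrientation decomp.charted := by
  rw [charted_decomp, chronologicalPast_O,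
    univ_subset_iff.mp (LorentzianMetric.subset_causalFuture _ _ univ), univ_inter]

theorem honestCoreABC_decomp (R₀ : ℝ) : HonestCoreABC 𝕄 O 2 decomp R₀ :=
  ⟨fun i ↦ i.elim0, fun i ↦ i.elim0, fun i ↦ i.elim0⟩

theorem seamed_decomp (R : Fin decomp.N → ℝ → ℝ) : Seamed 𝕄 O decomp R 0 := by
  refine ⟨fun i ↦ i.elim0, fun i ↦ i.elim0, ?_, fun i ↦ i.elim0, fun i ↦ i.elim0, fun i ↦ i.elim0,
    fun _ _ j ↦ j.elim0, fun j ↦ j.elim0, fun j ↦ j.elim0, fun j ↦ j.elim0, ?_, fun j ↦ j.elim0⟩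
  · show supCkENorm _ 0 ((𝕄).deviationExtend (Minkowski.backgroundOn ⊤) Φ) ≤ 10⁻¹
    rw [deviationExtend_Φ, supCkENorm_zero]
    exact zero_le
  · intro τ' _ x hx
    have hc : IsClosed {x : E4 | x 0 ≤ -τ'} := isClosed_le (PiLp.continuous_apply 2 _ 0) continuous_const
    have hx' : x ∈ closure (Φ '' {y : (⊤ : Opens E4) | τ' ≤ y.1 0} : Set E4) := hx
    rw [image_Φ_ge, hc.closure_eq] at hx'
    left
    have : x ∈ (Φ '' {y : (⊤ : Opens E4) | τ' ≤ y.1 0} : Set E4) := by rw [image_Φ_ge]; exact hx'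
    exact this

/-- The reversed decomposition violates exhaustion at `τ₁ = 1`: `p = (−1/2, 0) ∈ O` is neither flat-late
after `1` (that region is `{x⁰ < −1}`) nor in `J⁻(flat slab at 1) = J⁻({x⁰ = −1}) = {x⁰ ≤ −1}`. -/
theorem not_hasExhaustiveCharts_decomp : ¬ HasExhaustiveCharts decomp := by
  rintro ⟨R, -, hcov⟩
  set p : E4 := (-(1 / 2 : ℝ)) • E4.basisVector 0 with hp
  have hp0 : p 0 = -(1 / 2) := by simp [hp]
  have hpO : p ∈ O := by show p 0 < 0; rw [hp0]; norm_num
  have hpF : p ∉ certifiedLate decomp R 1 := by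
    rintro (h | h)
    · have h' : p ∈ (Φ '' (Minkowski.backgroundOn ⊤).lateRegion 1 : Set E4) := h
      rw [image_Φ_lateRegion] at h'
      have : p 0 < -1 := h'
      linarith
    · obtain ⟨i, -⟩ := mem_iUnion.mp h
      exact i.elim0
  have hmem := hcov 1 (show decomp.τ₀ < 1 from one_pos) ⟨hpO, hpF⟩
  obtain ⟨q, hq, hpq⟩ := exists_mem_causalPast_singleton_of_mem_causalPast hmem
  have hle := time_le_of_mem_causalPast_singleton hpq
  rcases hq with hq | hq
  · have hq' : q ∈ (Φ '' (Minkowski.backgroundOn ⊤).timeSlab 1 : Set E4) := hq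
    rw [image_Φ_timeSlab] at hq'
    have : q 0 = -1 := hq'
    linarith
  · obtain ⟨i, -⟩ := mem_iUnion.mp hq
    exact i.elim0

end ReversedModel

/-- **`HonestCore` (d) is load-bearing for the core.** The spacetime-level crux with the
future-orientation clause of the flat chart deleted is FALSE: Minkowski spacetime, `Σ = ℝ⁴`,
`O = {x⁰ < 0}`, no hole, flat chart the time reversal `x ↦ (−x⁰, x̲)` on `⊤ ⊇ {x⁰ > 0}` (an exact
anti-chronous isometry, so every SEAMED clause holds with vanishing deviations), `τ₁ = 1`,
`p = (−1/2, 0)`. O'Neill 1983, Ch. 14, p. 402 (causality of `ℝ⁴₁`). [folklore] -/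
theorem not_withoutFutureOrientation : ¬ WithoutFutureOrientation := fun h ↦
  ReversedModel.not_hasExhaustiveCharts_decomp
    (h Minkowski.spacetime univ ReversedModel.O ReversedModel.decomp Fin.elim0 0 ReversedModel.O_eq
      (ReversedModel.honestCoreABC_decomp 0) (ReversedModel.seamed_decomp _))


/-! ## §4 No counterexample with `N = 0`: the core holds without any hole (positive, for orientation)

`hasExhaustiveCharts_of_N_eq_zero`: for a decomposition with NO hole, `O ⊆ I⁻(d.charted)`, `HonestCore` (d)
and the `N = 0` form of SEAMED (11) already give `HasExhaustiveCharts d`. The proof is the `N = 0` shadow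
of (α)/(β): a point `p ∈ O` is `≪ Φ(y)` with `y⁰ > τ₀`; if `y⁰ ≤ τ₁` FLOW along the `e₀`-line to the flat
slab `{x⁰ = τ₁}` (`line_mem_causalFuture`, the coordinate-line lemma the provers need for every flow of
(α), stated for an arbitrary chart on an open subset of `E4` and an arbitrary direction `v`); if
`y⁰ > τ₁`, follow the timelike curve from `Φ(y)` down to `p` and take the LAST parameter at which it meets
`closure (Φ '' {x⁰ > τ₁})`: by (11) that point is `Φ(z)` with `z⁰ ≥ τ₁`, and `z⁰ > τ₁` is impossible
(open embedding: the curve would stay inside a little longer, or `p` itself would be certified-late),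
so `z⁰ = τ₁` and `p ≤ Φ(z) ∈ certifiedSlab`. Consequently every counterexample to the crux, if any, needs
a hole chart (`N ≥ 1`), where no spacetime with a settling Kerr near zone is constructible in the tree. -/

section Flow

variable {𝓢 : Spacetime.{0} 4}

/-- **Coordinate lines through a chart are causal curves.** Let `Φ : U → 𝓢` be smooth on an open
`U ⊆ E4`, `v ∈ E4`, and suppose the segment `σ ↦ y + σ v`, `σ ∈ [−ε, s + ε]`, lies in `U` and `dΦ(v)` is
future-directed causal along `σ ∈ [0, s]`. Then `Φ(y) ≤ Φ(y + s v)`. (The parameter is clamped to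
`[−ε, s + ε]` to obtain a globally defined curve that is differentiable on the CLOSED interval `[0, s]`,
as the tree's `IsFutureCausalCurveOn` demands.) O'Neill 1983, Ch. 14, p. 402. [folklore] -/
theorem line_mem_causalFuture {U : Opens E4} {Φ : U → 𝓢.carrier}
    (hΦ : ContMDiff 𝓘(ℝ, E4) (𝓡 4) ∞ Φ) (v y : E4) (hy : y ∈ U) {s ε : ℝ} (hs : 0 ≤ s) (hε : 0 < ε)
    (hmem : ∀ σ ∈ Icc (-ε) (s + ε), y + σ • v ∈ U)
    (hfut : ∀ z : U, z.1 ∈ (fun σ : ℝ ↦ y + σ • v) '' Icc 0 s →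
      𝓢.timeOrientation.IsFutureDirected (mfderiv 𝓘(ℝ, E4) (𝓡 4) Φ z v)) :
    Φ ⟨y + s • v, hmem s ⟨by linarith, by linarith⟩⟩ ∈
      𝓢.metric.causalFuture 𝓢.timeOrientation {Φ ⟨y, hy⟩} := by
  rcases hs.eq_or_lt with hs0 | hs'
  · subst hs0
    have : (⟨y + (0 : ℝ) • v, hmem 0 ⟨by linarith, by linarith⟩⟩ : U) = ⟨y, hy⟩ := Subtype.ext (by simp)
    rw [this]
    exact Or.inl rfl
  -- clamp the parameter
  set c : ℝ → ℝ := fun σ ↦ max (-ε) (min σ (s + ε)) with hc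
  have hcmem : ∀ σ, c σ ∈ Icc (-ε) (s + ε) := fun σ ↦
    ⟨le_max_left _ _, max_le (by linarith) (min_le_right _ _)⟩
  have hcid : ∀ σ ∈ Ioo (-ε) (s + ε), c σ = σ := fun σ hσ ↦ by
    simp only [hc]
    rw [min_eq_left hσ.2.le, max_eq_right hσ.1.le]
  set ι : ℝ → U := fun σ ↦ ⟨y + c σ • v, hmem (c σ) (hcmem σ)⟩ with hι
  have hιval : ∀ σ, (ι σ).1 = y + c σ • v := fun σ ↦ rfl
  set γ : ℝ → 𝓢.carrier := fun σ ↦ Φ (ι σ) with hγ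
  have hι0 : ι 0 = ⟨y, hy⟩ := Subtype.ext (by
    rw [hιval, hcid 0 ⟨by linarith, by linarith⟩]; simp)
  have hιs : ι s = ⟨y + s • v, hmem s ⟨by linarith, by linarith⟩⟩ := Subtype.ext (by
    rw [hιval, hcid s ⟨by linarith, by linarith⟩])
  refine Or.inr ⟨Φ ⟨y, hy⟩, rfl, γ, 0, s, hs', ?_, ?_, ?_⟩
  · intro t ht
    have htI : t ∈ Ioo (-ε) (s + ε) := ⟨by linarith [ht.1], by linarith [ht.2]⟩
    have hev : ∀ᶠ σ in 𝓝 t, c σ = σ :=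
      Filter.eventually_of_mem (isOpen_Ioo.mem_nhds htI) fun σ hσ ↦ hcid σ hσ
    have hval : (Subtype.val ∘ ι) =ᶠ[𝓝 t] fun σ : ℝ ↦ y + σ • v :=
      hev.mono fun σ hσ ↦ by simp only [Function.comp_apply, hιval, hσ]
    have haff : ContMDiff 𝓘(ℝ, ℝ) 𝓘(ℝ, E4) ∞ (fun σ : ℝ ↦ y + σ • v) :=
      (contDiff_const.add (contDiff_id.smul contDiff_const)).contMDiff
    have hιs' : ContMDiffAt 𝓘(ℝ, ℝ) 𝓘(ℝ, E4) ∞ ι t := by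
      rw [← ContMDiffAt.subtypeVal_comp_iff]
      exact haff.contMDiffAt.congr_of_eventuallyEq hval
    have hιd : MDifferentiableAt 𝓘(ℝ, ℝ) 𝓘(ℝ, E4) ι t := hιs'.mdifferentiableAt (by simp)
    have hΦd : MDifferentiableAt 𝓘(ℝ, E4) (𝓡 4) Φ (ι t) := hΦ.mdifferentiableAt (by simp)
    have hγd : MDifferentiableAt 𝓘(ℝ, ℝ) (𝓡 4) γ t := hΦd.comp t hιd
    -- the velocity of `ι` is `v`
    have hder : HasDerivAt (fun σ : ℝ ↦ y + σ • v) v t := by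
      simpa using ((hasDerivAt_id t).smul_const v).const_add y
    have h3 : mfderiv 𝓘(ℝ, ℝ) 𝓘(ℝ, E4) (fun σ : ℝ ↦ y + σ • v) t (1 : ℝ) = v := by
      rw [mfderiv_eq_fderiv]
      change fderiv ℝ (fun σ : ℝ ↦ y + σ • v) t 1 = v
      rw [hder.hasFDerivAt.fderiv]
      simp
    have hvι : mfderiv 𝓘(ℝ, ℝ) 𝓘(ℝ, E4) ι t (1 : ℝ) = v := by
      have h1 : mfderiv 𝓘(ℝ, ℝ) 𝓘(ℝ, E4) (Subtype.val ∘ ι) t =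
          (mfderiv 𝓘(ℝ, E4) 𝓘(ℝ, E4) (Subtype.val : U → E4) (ι t)).comp
            (mfderiv 𝓘(ℝ, ℝ) 𝓘(ℝ, E4) ι t) :=
        mfderiv_comp t
          ((contMDiff_subtype_val : ContMDiff 𝓘(ℝ, E4) 𝓘(ℝ, E4) ∞ (Subtype.val : U → E4)).mdifferentiableAt
            (by simp)) hιd
      have h2 : mfderiv 𝓘(ℝ, ℝ) 𝓘(ℝ, E4) (Subtype.val ∘ ι) t =
          mfderiv 𝓘(ℝ, ℝ) 𝓘(ℝ, E4) (fun σ : ℝ ↦ y + σ • v) t := hval.mfderiv_eq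
      have h4 : (mfderiv 𝓘(ℝ, E4) 𝓘(ℝ, E4) (Subtype.val : U → E4) (ι t))
          ((mfderiv 𝓘(ℝ, ℝ) 𝓘(ℝ, E4) ι t) (1 : ℝ)) =
          (mfderiv 𝓘(ℝ, ℝ) 𝓘(ℝ, E4) (fun σ : ℝ ↦ y + σ • v) t) (1 : ℝ) := by
        have := congrArg (fun L ↦ L (1 : ℝ)) h1
        rw [h2] at this
        exact this.symm
      rw [h3, OpensChart.mfderiv_subtypeVal_apply] at h4
      exact h4
    have hvel : velocity (𝓡 4) γ t = mfderiv 𝓘(ℝ, E4) (𝓡 4) Φ (ι t) v := by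
      unfold velocity
      rw [show γ = Φ ∘ ι from rfl, mfderiv_comp t hΦd hιd]
      show (mfderiv 𝓘(ℝ, E4) (𝓡 4) Φ (ι t)) ((mfderiv 𝓘(ℝ, ℝ) 𝓘(ℝ, E4) ι t) (1 : ℝ)) = _
      rw [hvι]
    refine ⟨hγd, ?_⟩
    rw [hvel]
    refine hfut (ι t) ⟨c t, ?_, (hιval t).symm⟩
    rw [hcid t htI]
    exact ht
  · show Φ (ι 0) = Φ ⟨y, hy⟩
    rw [hι0]
  · show Φ (ι s) = Φ ⟨y + s • v, hmem s ⟨by linarith, by linarith⟩⟩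
    rw [hιs]

/-- The `N = 0` case of the core, PROVED: no hole, `O ⊆ I⁻(d.charted)`, `HonestCore` (d) and SEAMED (11)
(in its `N = 0` form: the images of the closed flat-late slabs `{x⁰ ≥ τ'}`, `τ' > τ₀`, are closed) imply
`HasExhaustiveCharts d`. In particular a counterexample to `SeamedChartsExhaust` needs `N ≥ 1`.
O'Neill 1983, Ch. 14, pp. 402–403. [folklore] -/
theorem hasExhaustiveCharts_of_N_eq_zero {O : Set 𝓢.carrier} {k : ℕ}
    (d : FinalStateDecomposition 𝓢 O k) (hN : d.N = 0)
    (hO : O ⊆ 𝓢.metric.chronologicalPast 𝓢.timeOrientation d.charted)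
    (hfut : ∀ y : d.flatDomain, d.τ₀ < y.1 0 →
      𝓢.timeOrientation.IsFutureDirected (mfderiv 𝓘(ℝ, E4) (𝓡 4) d.flatChart y (E4.basisVector 0)))
    (h11 : ∀ τ' : ℝ, d.τ₀ < τ' →
      closure (d.flatChart '' {y | τ' ≤ y.1 0}) ⊆ d.flatChart '' {y | τ' ≤ y.1 0}) :
    HasExhaustiveCharts d := by
  haveI : IsEmpty (Fin d.N) := ⟨fun i ↦ (Fin.cast hN i).elim0⟩
  have hn : (2 : WithTop ℕ∞) ≤ ((⊤ : ℕ∞) : WithTop ℕ∞) := WithTop.coe_le_coe.mpr le_top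
  set Φ := d.flatChart with hΦdef
  set B := Minkowski.backgroundOn d.flatDomain with hB
  refine ⟨fun _ _ ↦ 0, fun i ↦ (Fin.cast hN i).elim0, fun τ₁ hτ₁ p hp ↦ ?_⟩
  obtain ⟨hpO, hpF⟩ := hp
  have hch : d.charted = Φ '' B.lateRegion d.τ₀ := by
    rw [FinalStateDecomposition.charted, iUnion_of_empty, union_empty]; rfl
  have hCL : certifiedLate d (fun _ _ ↦ 0) τ₁ = Φ '' B.lateRegion τ₁ := by
    rw [certifiedLate, iUnion_of_empty, union_empty]
  have hCS : certifiedSlab d (fun _ _ ↦ 0) τ₁ = Φ '' B.timeSlab τ₁ := by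
    rw [certifiedSlab, iUnion_of_empty, union_empty]
  rw [hCL] at hpF
  rw [hCS]
  obtain ⟨q, hq, γ, a, b, hab, hγ, hγa, hγb⟩ := hO hpO
  rw [hch] at hq
  obtain ⟨y, hy, rfl⟩ := hq
  have hy' : d.τ₀ < y.1 0 := hy
  -- `J⁻` bookkeeping
  have Jmono : ∀ {w : 𝓢.carrier}, w ∈ Φ '' B.timeSlab τ₁ →
      𝓢.metric.causalPast 𝓢.timeOrientation {w} ⊆
        𝓢.metric.causalPast 𝓢.timeOrientation (Φ '' B.timeSlab τ₁) :=
    fun hw ↦ causalFuture_mono (singleton_subset_iff.mpr hw)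
  have Jtrans : ∀ {u w x : 𝓢.carrier}, u ∈ 𝓢.metric.causalPast 𝓢.timeOrientation {w} →
      w ∈ 𝓢.metric.causalPast 𝓢.timeOrientation {x} → u ∈ 𝓢.metric.causalPast 𝓢.timeOrientation {x} := by
    intro u w x hu hw
    have : u ∈ 𝓢.metric.causalPast 𝓢.timeOrientation (𝓢.metric.causalPast 𝓢.timeOrientation {x}) :=
      causalFuture_mono (singleton_subset_iff.mpr hw) hu
    rwa [LorentzianMetric.causalPast, LorentzianMetric.causalPast,
      causalFuture_causalFuture_eq hn] at this
  rcases le_or_gt (y.1 0) τ₁ with hle | hlt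
  · -- Case A: flow from `y` up to the slab `{x⁰ = τ₁}`
    set s := τ₁ - y.1 0 with hs
    have hs0 : 0 ≤ s := by linarith
    set ε := (y.1 0 - d.τ₀) / 2 with hεdef
    have hε : 0 < ε := by rw [hεdef]; linarith
    have hmem : ∀ σ ∈ Icc (-ε) (s + ε), y.1 + σ • E4.basisVector 0 ∈ d.flatDomain := by
      intro σ hσ
      apply d.setOf_lt_excision_subset_flatDomain
      refine ⟨?_, fun i ↦ (Fin.cast hN i).elim0⟩
      show d.τ₀ < (y.1 + σ • E4.basisVector 0) 0
      have h1 : -ε ≤ σ := hσ.1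
      simp
      linarith
    have hflow := line_mem_causalFuture d.isLateChart_flat.contMDiff (E4.basisVector 0) y.1 y.2 hs0 hε
      hmem (by
        rintro z ⟨σ, hσ, hzσ⟩
        apply hfut
        show d.τ₀ < z.1 0
        rw [← hzσ]
        have h1 : 0 ≤ σ := hσ.1
        simp
        linarith)
    have hz : (⟨y.1 + s • E4.basisVector 0, hmem s ⟨by linarith, by linarith⟩⟩ : d.flatDomain) ∈
        B.timeSlab τ₁ := by
      show (y.1 + s • E4.basisVector 0) 0 = τ₁
      simp [hs]
    have hpy : p ∈ 𝓢.metric.causalPast 𝓢.timeOrientation {Φ y} :=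
      Or.inr ⟨Φ y, rfl, γ, a, b, hab, hγ.isFutureCausalCurveOn, hγa, hγb⟩
    exact Jmono (mem_image_of_mem Φ hz) (Jtrans hpy (mem_causalPast_of_mem_causalFuture hflow))
  · -- Case B: last parameter in the closure of the certified-late region
    have hCLopen : IsOpen (Φ '' B.lateRegion τ₁) := by
      have hemb := d.isLateChart_flat.isOpenEmbedding
      have hsub : Φ '' B.lateRegion τ₁ =
          (B.lateRegion d.τ₀).restrict Φ '' {z : B.lateRegion d.τ₀ | τ₁ < z.1.1 0} := by
        ext w
        constructor
        · rintro ⟨z, hz, rfl⟩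
          have hz' : τ₁ < z.1 0 := hz
          exact ⟨⟨z, show d.τ₀ < z.1 0 by linarith⟩, hz', rfl⟩
        · rintro ⟨z, hz, rfl⟩
          exact ⟨z.1, hz, rfl⟩
      rw [hsub]
      refine hemb.isOpenMap _ ?_
      exact isOpen_lt continuous_const
        ((PiLp.continuous_apply 2 _ 0).comp (continuous_subtype_val.comp continuous_subtype_val))
    -- continuity of γ on [a, b]
    have hγcont : ContinuousOn γ (Icc a b) := fun t ht ↦
      (hγ.isFutureCausalCurveOn.continuousAt ht).continuousWithinAt
    set S : Set ℝ := Icc a b ∩ γ ⁻¹' closure (Φ '' B.lateRegion τ₁) with hSdef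
    have hSclosed : IsClosed S := hγcont.preimage_isClosed_of_isClosed isClosed_Icc isClosed_closure
    have haS : a ∈ S := ⟨left_mem_Icc.mpr hab.le, by
      show γ a ∈ closure (Φ '' B.lateRegion τ₁)
      rw [hγa]; exact subset_closure ⟨y, hlt, rfl⟩⟩
    have hSbdd : BddAbove S := ⟨b, fun t ht ↦ ht.1.2⟩
    set t₀ := sSup S with ht₀
    have ht₀S : t₀ ∈ S := hSclosed.csSup_mem ⟨a, haS⟩ hSbdd
    have ht₀b : t₀ ≤ b := ht₀S.1.2
    -- the point γ t₀ is flat-charted with flat time ≥ τ₁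
    have hsub' : B.lateRegion τ₁ ⊆ {z : d.flatDomain | τ₁ ≤ z.1 0} := fun z hz ↦
      show τ₁ ≤ z.1 0 from le_of_lt hz
    have hzcl : γ t₀ ∈ closure (Φ '' {z : d.flatDomain | τ₁ ≤ z.1 0}) :=
      closure_mono (image_mono hsub') ht₀S.2
    obtain ⟨z, hz, hγz⟩ := h11 τ₁ hτ₁ hzcl
    have hz' : τ₁ ≤ z.1 0 := hz
    rcases hz'.eq_or_lt with hzeq | hzlt
    · -- on the slab: p ≤ γ t₀
      have hslab : γ t₀ ∈ Φ '' B.timeSlab τ₁ := ⟨z, hzeq.symm, hγz⟩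
      rcases ht₀b.eq_or_lt with htb | htb
      · -- t₀ = b: p itself is on the slab
        rw [htb, hγb] at hslab
        exact subset_causalPast _ _ _ hslab
      · refine Jmono hslab (Or.inr ⟨γ t₀, rfl, γ, t₀, b, htb, ?_, rfl, hγb⟩)
        exact (hγ.mono (Icc_subset_Icc ht₀S.1.1 le_rfl)).isFutureCausalCurveOn
    · -- strictly later than τ₁: γ t₀ is certified-late, contradiction with maximality of t₀
      exfalso
      have hin : γ t₀ ∈ Φ '' B.lateRegion τ₁ := ⟨z, hzlt, hγz⟩
      rcases ht₀b.eq_or_lt with htb | htb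
      · apply hpF
        rw [← hγb, ← htb]
        exact hin
      · -- γ stays in the open set a little after t₀
        have hct : ContinuousAt γ t₀ := hγ.isFutureCausalCurveOn.continuousAt ht₀S.1
        have hev : ∀ᶠ t in 𝓝 t₀, γ t ∈ Φ '' B.lateRegion τ₁ := hct (hCLopen.mem_nhds hin)
        obtain ⟨δ, hδ, hball⟩ := Metric.eventually_nhds_iff.mp hev
        set t₁ := min (t₀ + δ / 2) b with ht₁
        have ht₁gt : t₀ < t₁ := lt_min (by linarith) htb
        have ht₁S : t₁ ∈ S := by
          refine ⟨⟨by linarith [ht₀S.1.1], min_le_right _ _⟩, subset_closure (hball ?_)⟩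
          rw [Real.dist_eq, abs_lt]
          constructor <;> linarith [min_le_left (t₀ + δ / 2) b]
        have := le_csSup hSbdd ht₁S
        linarith

/-- Timelike variant of `line_mem_causalFuture`: if moreover `dΦ(v)` is timelike along `σ ∈ [0, s]`
and `s > 0`, then `Φ(y) ≪ Φ(y + s v)`. O'Neill 1983, Ch. 14, p. 402. [folklore] -/
theorem line_mem_chronologicalFuture {U : Opens E4} {Φ : U → 𝓢.carrier}
    (hΦ : ContMDiff 𝓘(ℝ, E4) (𝓡 4) ∞ Φ) (v y : E4) (hy : y ∈ U) {s ε : ℝ} (hs : 0 < s) (hε : 0 < ε)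
    (hmem : ∀ σ ∈ Icc (-ε) (s + ε), y + σ • v ∈ U)
    (hfut : ∀ z : U, z.1 ∈ (fun σ : ℝ ↦ y + σ • v) '' Icc 0 s →
      𝓢.timeOrientation.IsFutureDirected (mfderiv 𝓘(ℝ, E4) (𝓡 4) Φ z v))
    (htl : ∀ z : U, z.1 ∈ (fun σ : ℝ ↦ y + σ • v) '' Icc 0 s →
      𝓢.metric.IsTimelike (mfderiv 𝓘(ℝ, E4) (𝓡 4) Φ z v)) :
    Φ ⟨y + s • v, hmem s ⟨by linarith, by linarith⟩⟩ ∈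
      𝓢.metric.chronologicalFuture 𝓢.timeOrientation {Φ ⟨y, hy⟩} := by
  have hs' : 0 < s := hs
  -- clamp the parameter
  set c : ℝ → ℝ := fun σ ↦ max (-ε) (min σ (s + ε)) with hc
  have hcmem : ∀ σ, c σ ∈ Icc (-ε) (s + ε) := fun σ ↦
    ⟨le_max_left _ _, max_le (by linarith) (min_le_right _ _)⟩
  have hcid : ∀ σ ∈ Ioo (-ε) (s + ε), c σ = σ := fun σ hσ ↦ by
    simp only [hc]
    rw [min_eq_left hσ.2.le, max_eq_right hσ.1.le]
  set ι : ℝ → U := fun σ ↦ ⟨y + c σ • v, hmem (c σ) (hcmem σ)⟩ with hι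
  have hιval : ∀ σ, (ι σ).1 = y + c σ • v := fun σ ↦ rfl
  set γ : ℝ → 𝓢.carrier := fun σ ↦ Φ (ι σ) with hγ
  have hι0 : ι 0 = ⟨y, hy⟩ := Subtype.ext (by
    rw [hιval, hcid 0 ⟨by linarith, by linarith⟩]; simp)
  have hιs : ι s = ⟨y + s • v, hmem s ⟨by linarith, by linarith⟩⟩ := Subtype.ext (by
    rw [hιval, hcid s ⟨by linarith, by linarith⟩])
  refine ⟨Φ ⟨y, hy⟩, rfl, γ, 0, s, hs', ?_, ?_, ?_⟩
  · intro t ht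
    have htI : t ∈ Ioo (-ε) (s + ε) := ⟨by linarith [ht.1], by linarith [ht.2]⟩
    have hev : ∀ᶠ σ in 𝓝 t, c σ = σ :=
      Filter.eventually_of_mem (isOpen_Ioo.mem_nhds htI) fun σ hσ ↦ hcid σ hσ
    have hval : (Subtype.val ∘ ι) =ᶠ[𝓝 t] fun σ : ℝ ↦ y + σ • v :=
      hev.mono fun σ hσ ↦ by simp only [Function.comp_apply, hιval, hσ]
    have haff : ContMDiff 𝓘(ℝ, ℝ) 𝓘(ℝ, E4) ∞ (fun σ : ℝ ↦ y + σ • v) :=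
      (contDiff_const.add (contDiff_id.smul contDiff_const)).contMDiff
    have hιs' : ContMDiffAt 𝓘(ℝ, ℝ) 𝓘(ℝ, E4) ∞ ι t := by
      rw [← ContMDiffAt.subtypeVal_comp_iff]
      exact haff.contMDiffAt.congr_of_eventuallyEq hval
    have hιd : MDifferentiableAt 𝓘(ℝ, ℝ) 𝓘(ℝ, E4) ι t := hιs'.mdifferentiableAt (by simp)
    have hΦd : MDifferentiableAt 𝓘(ℝ, E4) (𝓡 4) Φ (ι t) := hΦ.mdifferentiableAt (by simp)
    have hγd : MDifferentiableAt 𝓘(ℝ, ℝ) (𝓡 4) γ t := hΦd.comp t hιd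
    -- the velocity of `ι` is `v`
    have hder : HasDerivAt (fun σ : ℝ ↦ y + σ • v) v t := by
      simpa using ((hasDerivAt_id t).smul_const v).const_add y
    have h3 : mfderiv 𝓘(ℝ, ℝ) 𝓘(ℝ, E4) (fun σ : ℝ ↦ y + σ • v) t (1 : ℝ) = v := by
      rw [mfderiv_eq_fderiv]
      change fderiv ℝ (fun σ : ℝ ↦ y + σ • v) t 1 = v
      rw [hder.hasFDerivAt.fderiv]
      simp
    have hvι : mfderiv 𝓘(ℝ, ℝ) 𝓘(ℝ, E4) ι t (1 : ℝ) = v := by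
      have h1 : mfderiv 𝓘(ℝ, ℝ) 𝓘(ℝ, E4) (Subtype.val ∘ ι) t =
          (mfderiv 𝓘(ℝ, E4) 𝓘(ℝ, E4) (Subtype.val : U → E4) (ι t)).comp
            (mfderiv 𝓘(ℝ, ℝ) 𝓘(ℝ, E4) ι t) :=
        mfderiv_comp t
          ((contMDiff_subtype_val : ContMDiff 𝓘(ℝ, E4) 𝓘(ℝ, E4) ∞ (Subtype.val : U → E4)).mdifferentiableAt
            (by simp)) hιd
      have h2 : mfderiv 𝓘(ℝ, ℝ) 𝓘(ℝ, E4) (Subtype.val ∘ ι) t =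
          mfderiv 𝓘(ℝ, ℝ) 𝓘(ℝ, E4) (fun σ : ℝ ↦ y + σ • v) t := hval.mfderiv_eq
      have h4 : (mfderiv 𝓘(ℝ, E4) 𝓘(ℝ, E4) (Subtype.val : U → E4) (ι t))
          ((mfderiv 𝓘(ℝ, ℝ) 𝓘(ℝ, E4) ι t) (1 : ℝ)) =
          (mfderiv 𝓘(ℝ, ℝ) 𝓘(ℝ, E4) (fun σ : ℝ ↦ y + σ • v) t) (1 : ℝ) := by
        have := congrArg (fun L ↦ L (1 : ℝ)) h1
        rw [h2] at this
        exact this.symm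
      rw [h3, OpensChart.mfderiv_subtypeVal_apply] at h4
      exact h4
    have hvel : velocity (𝓡 4) γ t = mfderiv 𝓘(ℝ, E4) (𝓡 4) Φ (ι t) v := by
      unfold velocity
      rw [show γ = Φ ∘ ι from rfl, mfderiv_comp t hΦd hιd]
      show (mfderiv 𝓘(ℝ, E4) (𝓡 4) Φ (ι t)) ((mfderiv 𝓘(ℝ, ℝ) 𝓘(ℝ, E4) ι t) (1 : ℝ)) = _
      rw [hvι]
    have hmemt : (ι t).1 ∈ (fun σ : ℝ ↦ y + σ • v) '' Icc 0 s := by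
      refine ⟨c t, ?_, (hιval t).symm⟩
      rw [hcid t htI]
      exact ht
    refine ⟨hγd, ?_, ?_⟩
    · rw [hvel]
      exact htl (ι t) hmemt
    · rw [hvel]
      exact hfut (ι t) hmemt
  · show Φ (ι 0) = Φ ⟨y, hy⟩
    rw [hι0]
  · show Φ (ι s) = Φ ⟨y + s • v, hmem s ⟨by linarith, by linarith⟩⟩
    rw [hιs]



end Flow

/-! ## §5 The exact Schwarzschild model (N = 1, identity charts) -/

/-- `Kerr.Facts` is inhabited (all three fields are theorems in the tree). [folklore] -/
instance kerrFacts : Kerr.Facts :=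
  ⟨Kerr.isConnected_region_holds, Kerr.contMDiff_bilin_holds, Kerr.contMDiff_timeVector_holds⟩

namespace KerrTime

variable {M a r₀ : ℝ} {hM : 0 ≤ M}

-- `TangentSpace 𝓘(ℝ, ℝ) s` is definitionally `ℝ`; reading the manifold derivative of the real function
-- `x⁰ ∘ γ` as an ordinary derivative moves across this identification (same pattern as
-- `RedShiftedHorizon.monotoneOn_comp_of_isMIntegralCurveOn`).
set_option backward.isDefEq.respectTransparency false in
/-- Chain rule: the Kerr–Schild time `x⁰ ∘ γ` of a differentiable curve in the Kerr–Schild patch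
`{r > r₀}` has derivative `(γ'(s))⁰`. [folklore] -/
theorem hasDerivAt_time_comp {γ : ℝ → (Kerr.spacetime M a r₀ hM).carrier} {s : ℝ}
    (hγ : MDifferentiableAt 𝓘(ℝ, ℝ) (𝓡 4) γ s) :
    HasDerivAt (fun s ↦ (γ s).1 0) ((show E4 from velocity (𝓡 4) γ s) 0) s := by
  set P : E4 →L[ℝ] ℝ := EuclideanSpace.proj (0 : Fin 4) with hP
  have hφ : HasMFDerivAt (𝓡 4) 𝓘(ℝ, ℝ)
      (fun x : (Kerr.spacetime M a r₀ hM).carrier ↦ P x.1) (γ s)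
      (P.comp (ContinuousLinearMap.id ℝ E4)) :=
    P.hasMFDerivAt.comp (γ s) (hasMFDerivAt_subtypeVal (I' := 𝓡 4) (γ s))
  rw [hasDerivAt_iff_hasFDerivAt, ← hasMFDerivAt_iff_hasFDerivAt]
  apply (hφ.comp s hγ.hasMFDerivAt).congr_mfderiv
  rw [ContinuousLinearMap.ext_iff]
  intro (r : ℝ)
  have hr : (mfderiv 𝓘(ℝ, ℝ) (𝓡 4) γ s) r = r • (mfderiv 𝓘(ℝ, ℝ) (𝓡 4) γ s) (1 : ℝ) := by
    rw [← map_smul]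
    congr 1
    exact (mul_one r).symm
  change P ((mfderiv 𝓘(ℝ, ℝ) (𝓡 4) γ s) r) = r • (show E4 from velocity (𝓡 4) γ s) 0
  rw [hr, map_smul, smul_eq_mul, smul_eq_mul]
  rfl

/-- Future-directed vectors have positive time component: `g(V, v) = −v⁰ < 0` for `V = −g♯(dt*)`.
Dafermos–Rodnianski arXiv:0811.0354, §5.1. [folklore] -/
theorem velocity_zero_pos {x : (Kerr.spacetime M a r₀ hM).carrier} {v : E4}
    (hv : (Kerr.spacetime M a r₀ hM).timeOrientation.IsFutureDirected (x := x) v) : 0 < v 0 := by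
  have h2 := hv.2
  change Kerr.bilin M a x.1 (Kerr.timeVector M a x.1) v < 0 at h2
  rw [Kerr.bilin_timeVector (Kerr.radius_pos_of_mem_region x.2)] at h2
  simpa using h2

/-- Dually, future-directed vectors of the REVERSED orientation have negative time component.
[folklore] -/
theorem velocity_zero_neg {x : (Kerr.spacetime M a r₀ hM).carrier} {v : E4}
    (hv : (Kerr.spacetime M a r₀ hM).timeOrientation.reverse.IsFutureDirected (x := x) v) :
    v 0 < 0 := by
  rw [TimeOrientation.isFutureDirected_reverse_iff] at hv
  have h2 := hv.2
  change 0 < Kerr.bilin M a x.1 (Kerr.timeVector M a x.1) v at h2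
  rw [Kerr.bilin_timeVector (Kerr.radius_pos_of_mem_region x.2)] at h2
  simpa using h2

/-- **Kerr–Schild time is a time function on every Kerr–Schild patch** `{r > max r₀ 0}`, for all
`M ≥ 0` and all `a`: along a future causal curve the coordinate `x⁰ ∘ γ` is monotone (its
derivative is `(γ')⁰ = −g(V, γ') > 0`). Dafermos–Rodnianski arXiv:0811.0354, §5.1. [folklore] -/
theorem time_monotoneOn {γ : ℝ → (Kerr.spacetime M a r₀ hM).carrier} {s₁ s₂ : ℝ}
    (hγ : (Kerr.spacetime M a r₀ hM).metric.IsFutureCausalCurveOn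
      (Kerr.spacetime M a r₀ hM).timeOrientation γ (Icc s₁ s₂)) :
    MonotoneOn (fun s ↦ (γ s).1 0) (Icc s₁ s₂) := by
  have hcont : ContinuousOn (fun s ↦ (γ s).1 0) (Icc s₁ s₂) := fun s hs ↦
    (((PiLp.continuous_apply 2 _ 0).comp continuous_subtype_val).continuousAt.comp
      (hγ.continuousAt hs)).continuousWithinAt
  refine monotoneOn_of_hasDerivWithinAt_nonneg (convex_Icc s₁ s₂) hcont
    (fun s hs ↦ (hasDerivAt_time_comp (hγ s (interior_subset hs)).1).hasDerivWithinAt)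
    fun s hs ↦ (velocity_zero_pos (hγ s (interior_subset hs)).2).le

/-- Along a future causal curve of the REVERSED orientation, `x⁰ ∘ γ` is antitone. [folklore] -/
theorem time_antitoneOn {γ : ℝ → (Kerr.spacetime M a r₀ hM).carrier} {s₁ s₂ : ℝ}
    (hγ : (Kerr.spacetime M a r₀ hM).metric.IsFutureCausalCurveOn
      (Kerr.spacetime M a r₀ hM).timeOrientation.reverse γ (Icc s₁ s₂)) :
    AntitoneOn (fun s ↦ (γ s).1 0) (Icc s₁ s₂) := by
  have hcont : ContinuousOn (fun s ↦ (γ s).1 0) (Icc s₁ s₂) := fun s hs ↦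
    (((PiLp.continuous_apply 2 _ 0).comp continuous_subtype_val).continuousAt.comp
      (hγ.continuousAt hs)).continuousWithinAt
  refine antitoneOn_of_hasDerivWithinAt_nonpos (convex_Icc s₁ s₂) hcont
    (fun s hs ↦ (hasDerivAt_time_comp (hγ s (interior_subset hs)).1).hasDerivWithinAt)
    fun s hs ↦ (velocity_zero_neg (hγ s (interior_subset hs)).2).le

/-- `J⁻(S)` lies weakly below `S` in Kerr–Schild time. [folklore] -/
theorem time_le_of_mem_causalPast {S : Set (Kerr.spacetime M a r₀ hM).carrier}
    {p : (Kerr.spacetime M a r₀ hM).carrier}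
    (hp : p ∈ (Kerr.spacetime M a r₀ hM).metric.causalPast
      (Kerr.spacetime M a r₀ hM).timeOrientation S) :
    ∃ q ∈ S, p.1 0 ≤ q.1 0 := by
  rcases hp with hp | ⟨q, hq, γ, s₁, s₂, hs, hγ, hγ₁, hγ₂⟩
  · exact ⟨p, hp, le_rfl⟩
  · refine ⟨q, hq, ?_⟩
    have h := time_antitoneOn hγ ⟨le_rfl, hs.le⟩ ⟨hs.le, le_rfl⟩ hs.le
    simp only at h
    rw [hγ₁, hγ₂] at h
    exact h

/-- `J⁺(p)` lies weakly above `p` in Kerr–Schild time. [folklore] -/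
theorem time_le_of_mem_causalFuture {p q : (Kerr.spacetime M a r₀ hM).carrier}
    (hq : q ∈ (Kerr.spacetime M a r₀ hM).metric.causalFuture
      (Kerr.spacetime M a r₀ hM).timeOrientation {p}) :
    p.1 0 ≤ q.1 0 := by
  rcases hq with hq | ⟨p', hp', γ, s₁, s₂, hs, hγ, hγ₁, hγ₂⟩
  · rw [mem_singleton_iff] at hq; rw [hq]
  · rw [mem_singleton_iff] at hp'
    subst hp'
    have h := time_monotoneOn hγ ⟨le_rfl, hs.le⟩ ⟨hs.le, le_rfl⟩ hs.le
    simp only at h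
    rw [hγ₁, hγ₂] at h
    exact h

end KerrTime

/-! ### Schwarzschild Kerr–Schild algebra along the static Killing field `∂₀` -/

namespace Schw

theorem spatial_basisVector_zero : E4.spatial (E4.basisVector 0) = 0 := by
  ext i
  simp [E4.spatial]

theorem spatial_add_smul_e0 (x : E4) (σ : ℝ) :
    E4.spatial (x + σ • E4.basisVector 0) = E4.spatial x := by
  rw [map_add, map_smul, spatial_basisVector_zero, smul_zero, add_zero]

theorem radius_add_smul_e0 (a : ℝ) (x : E4) (σ : ℝ) :
    Kerr.radius a (x + σ • E4.basisVector 0) = Kerr.radius a x :=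
  Kerr.radius_eq_of_spatial_eq a (spatial_add_smul_e0 x σ)

theorem add_smul_e0_apply_zero (x : E4) (σ : ℝ) : (x + σ • E4.basisVector 0) 0 = x 0 + σ := by
  simp

/-- `H = M / r` for `a = 0` wherever `r > 0` (Schwarzschild). [folklore] -/
theorem scalarH_zero (M : ℝ) {x : E4} (hx : 0 < Kerr.radius 0 x) :
    Kerr.scalarH M 0 x = M / Kerr.radius 0 x := by
  unfold Kerr.scalarH
  have hr : Kerr.radius 0 x ≠ 0 := hx.ne'
  field_simp
  ring

/-- `g(∂₀, ∂₀) = −1 + 2H`. [folklore] -/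
theorem bilin_e0_e0 (M a : ℝ) (x : E4) :
    Kerr.bilin M a x (E4.basisVector 0) (E4.basisVector 0) = -1 + 2 * Kerr.scalarH M a x := by
  rw [Kerr.bilin_apply, Kerr.nullCovector_basisVector_zero, Minkowski.bilin_basisVector_zero]
  ring

/-- Outside the Schwarzschild radius `∂₀` is timelike: `g(∂₀, ∂₀) = −1 + 2M/r < 0` for
`r > 2M ≥ 0`. [folklore] -/
theorem bilin_e0_e0_neg {M : ℝ} (hM : 0 ≤ M) {x : E4} (hx : 2 * M < Kerr.radius 0 x) :
    Kerr.bilin M 0 x (E4.basisVector 0) (E4.basisVector 0) < 0 := by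
  have hr : 0 < Kerr.radius 0 x := by linarith
  rw [bilin_e0_e0, scalarH_zero M hr]
  have : M / Kerr.radius 0 x < 1 / 2 := by
    rw [div_lt_iff₀ hr]; linarith
  linarith

theorem basisVector_zero_ne_zero : (E4.basisVector 0 : E4) ≠ 0 := by
  intro h
  have := congrArg (fun z : E4 ↦ z 0) h
  simp at this

variable {M r₀ : ℝ} {hM : 0 ≤ M}

/-- In the Schwarzschild patch `{r > r₀}`, `∂₀` is future-directed causal at every point with
`r > 2M`. [folklore] -/
theorem isFutureDirected_e0 (x : (Kerr.spacetime M 0 r₀ hM).carrier)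
    (hx : 2 * M < Kerr.radius 0 x.1) :
    (Kerr.spacetime M 0 r₀ hM).timeOrientation.IsFutureDirected (x := x) (E4.basisVector 0 : E4) := by
  refine ⟨⟨?_, basisVector_zero_ne_zero⟩, ?_⟩
  · change Kerr.bilin M 0 x.1 (E4.basisVector 0) (E4.basisVector 0) ≤ 0
    exact (bilin_e0_e0_neg hM hx).le
  · change Kerr.bilin M 0 x.1 (Kerr.timeVector M 0 x.1) (E4.basisVector 0) < 0
    rw [Kerr.bilin_timeVector (Kerr.radius_pos_of_mem_region x.2)]
    simp

theorem isTimelike_e0 (x : (Kerr.spacetime M 0 r₀ hM).carrier) (hx : 2 * M < Kerr.radius 0 x.1) :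
    (Kerr.spacetime M 0 r₀ hM).metric.IsTimelike (x := x) (E4.basisVector 0 : E4) := by
  change Kerr.bilin M 0 x.1 (E4.basisVector 0) (E4.basisVector 0) < 0
  exact bilin_e0_e0_neg hM hx

theorem mfderiv_self_apply (z : Kerr.region (0 : ℝ) r₀) (v : E4) :
    mfderiv 𝓘(ℝ, E4) (𝓡 4) (fun z : Kerr.region (0 : ℝ) r₀ ↦ z) z v = v := by
  have : (fun z : Kerr.region (0 : ℝ) r₀ ↦ z) = id := rfl
  rw [this]
  erw [mfderiv_id]
  rfl

/-- **The static flow is causal**: for `x` in the patch with `r(x) > 2M` and `s ≥ 0`, the point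
`x + s ∂₀` (same radius) lies in `J⁺(x)`. [folklore] -/
theorem vertical_mem_causalFuture (x : (Kerr.spacetime M 0 r₀ hM).carrier)
    (hx : 2 * M < Kerr.radius 0 x.1) {s : ℝ} (hs : 0 ≤ s)
    (hmem : x.1 + s • E4.basisVector 0 ∈ Kerr.region 0 r₀) :
    (⟨x.1 + s • E4.basisVector 0, hmem⟩ : (Kerr.spacetime M 0 r₀ hM).carrier) ∈
      (Kerr.spacetime M 0 r₀ hM).metric.causalFuture (Kerr.spacetime M 0 r₀ hM).timeOrientation
        {x} := by
  have hmem' : ∀ σ ∈ Icc (-1) (s + 1), x.1 + σ • E4.basisVector 0 ∈ Kerr.region 0 r₀ := by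
    intro σ _
    show max r₀ 0 < Kerr.radius 0 (x.1 + σ • E4.basisVector 0)
    rw [radius_add_smul_e0]; exact x.2
  have key := line_mem_causalFuture (𝓢 := Kerr.spacetime M 0 r₀ hM) (U := Kerr.region 0 r₀)
    (Φ := fun z ↦ z) contMDiff_id (E4.basisVector 0) x.1 x.2 hs one_pos hmem' (by
      rintro z ⟨σ, -, hz⟩
      have hrad : 2 * M < Kerr.radius 0 z.1 := by rw [← hz, radius_add_smul_e0]; exact hx
      exact (congrArg (fun w : E4 ↦ (Kerr.spacetime M 0 r₀ hM).timeOrientation.IsFutureDirected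
        (x := z) w) (mfderiv_self_apply z (E4.basisVector 0))).mpr
          (isFutureDirected_e0 (hM := hM) z hrad))
  exact key

/-- **The static flow is timelike**: `x ≪ x + s ∂₀` for `s > 0` and `r(x) > 2M`. [folklore] -/
theorem vertical_mem_chronologicalFuture (x : (Kerr.spacetime M 0 r₀ hM).carrier)
    (hx : 2 * M < Kerr.radius 0 x.1) {s : ℝ} (hs : 0 < s)
    (hmem : x.1 + s • E4.basisVector 0 ∈ Kerr.region 0 r₀) :
    (⟨x.1 + s • E4.basisVector 0, hmem⟩ : (Kerr.spacetime M 0 r₀ hM).carrier) ∈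
      (Kerr.spacetime M 0 r₀ hM).metric.chronologicalFuture
        (Kerr.spacetime M 0 r₀ hM).timeOrientation {x} := by
  have hmem' : ∀ σ ∈ Icc (-1) (s + 1), x.1 + σ • E4.basisVector 0 ∈ Kerr.region 0 r₀ := by
    intro σ _
    show max r₀ 0 < Kerr.radius 0 (x.1 + σ • E4.basisVector 0)
    rw [radius_add_smul_e0]; exact x.2
  have key := line_mem_chronologicalFuture (𝓢 := Kerr.spacetime M 0 r₀ hM)
    (U := Kerr.region 0 r₀) (Φ := fun z ↦ z) contMDiff_id (E4.basisVector 0) x.1 x.2 hs one_pos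
    hmem' (by
      rintro z ⟨σ, -, hz⟩
      have hrad : 2 * M < Kerr.radius 0 z.1 := by rw [← hz, radius_add_smul_e0]; exact hx
      exact (congrArg (fun w : E4 ↦ (Kerr.spacetime M 0 r₀ hM).timeOrientation.IsFutureDirected
        (x := z) w) (mfderiv_self_apply z (E4.basisVector 0))).mpr
          (isFutureDirected_e0 (hM := hM) z hrad)) (by
      rintro z ⟨σ, -, hz⟩
      have hrad : 2 * M < Kerr.radius 0 z.1 := by rw [← hz, radius_add_smul_e0]; exact hx
      exact (congrArg (fun w : E4 ↦ (Kerr.spacetime M 0 r₀ hM).metric.IsTimelike (x := z) w)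
        (mfderiv_self_apply z (E4.basisVector 0))).mpr (isTimelike_e0 (hM := hM) z hrad))
  exact key

end Schw

/-! ### The model: parameters, spacetime, charts -/

namespace SchwModel

/-- Parameters of the exact Schwarzschild model: mass `M > 0`, inner radius `0 < r₀ ≤ 2M` of the
ambient Kerr–Schild patch (`r₀ = 2M`: the exterior only; `r₀ < 2M`: horizon-penetrating), and the
anchoring radius `R₀ ≥ 100 M` of the clause set. -/
structure Params where
  /-- mass -/
  M : ℝ
  /-- inner radius of the ambient patch -/
  r₀ : ℝ
  /-- anchoring radius `R₀` of `HonestCore`/`Seamed` -/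
  R₀ : ℝ
  hM : 0 < M
  hr₀ : 0 < r₀
  hr₂ : r₀ ≤ 2 * M
  hR₀ : 100 * M ≤ R₀

variable (P : Params)

namespace Params

theorem two_M_pos : 0 < 2 * P.M := by linarith [P.hM]
theorem two_M_lt_R₀ : 2 * P.M < P.R₀ := by linarith [P.hM, P.hR₀]
theorem R₀_pos : 0 < P.R₀ := by linarith [P.hM, P.hR₀]
theorem rPlus_eq : Kerr.rPlus P.M 0 = 2 * P.M := Kerr.rPlus_zero_right P.hM.le
theorem max_r₀ : max P.r₀ 0 = P.r₀ := max_eq_left P.hr₀.le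

end Params

/-- The ambient spacetime: the Schwarzschild Kerr–Schild patch `{r > r₀}`. -/
def ST : Spacetime.{0} 4 := Kerr.spacetime P.M 0 P.r₀ P.hM.le

/-- Flat tube radius `ρ(t) = R₀ + 1 + √t` (sublinear, `≥ R₀`). -/
def ρ (t : ℝ) : ℝ := P.R₀ + 1 + √t

/-- Certified radius `R(s) = R₀ + 4 + √s` (monotone, continuous, `≥ R₀ + 4`, `≥ ρ + 3`). -/
def Rc (s : ℝ) : ℝ := P.R₀ + 4 + √s

theorem ρ_ge (t : ℝ) : P.R₀ + 1 ≤ ρ P t := le_add_of_nonneg_right (Real.sqrt_nonneg t)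
theorem Rc_eq (s : ℝ) : Rc P s = ρ P s + 3 := by unfold Rc ρ; ring
theorem continuous_ρ : Continuous (ρ P) := continuous_const.add Real.continuous_sqrt
theorem continuous_Rc : Continuous (Rc P) := continuous_const.add Real.continuous_sqrt
theorem monotone_Rc : Monotone (Rc P) := fun _ _ h ↦ by
  unfold Rc; linarith [Real.sqrt_le_sqrt h]
theorem two_M_lt_ρ (t : ℝ) : 2 * P.M < ρ P t := by linarith [P.two_M_lt_R₀, ρ_ge P t]

/-- The flat coordinate domain `U = {x⁰ > −1, r > ρ(x⁰)}` (it reaches slightly below `τ₀ = 0`, as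
ONE ATLAS (6) and clause (7) at coordinate time exactly `τ₀` demand). -/
def U : Opens E4 :=
  ⟨{x | -1 < x 0 ∧ ρ P (x 0) < Kerr.radius 0 x},
    (isOpen_lt continuous_const (PiLp.continuous_apply 2 _ 0)).inter
      (isOpen_lt ((continuous_ρ P).comp (PiLp.continuous_apply 2 _ 0)) (Kerr.continuous_radius 0))⟩

theorem mem_U {x : E4} : x ∈ U P ↔ -1 < x 0 ∧ ρ P (x 0) < Kerr.radius 0 x := Iff.rfl

theorem hext : (Kerr.background P.M 0).domain ≤ Kerr.region 0 P.r₀ := by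
  change Kerr.region 0 (Kerr.rPlus P.M 0) ≤ Kerr.region 0 P.r₀
  rw [P.rPlus_eq]
  exact Kerr.region_mono 0 P.hr₂

theorem mem_exterior_iff {x : E4} : x ∈ Kerr.exterior P.M 0 ↔ 2 * P.M < Kerr.radius 0 x := by
  rw [Kerr.mem_exterior, P.rPlus_eq, max_eq_left P.two_M_pos.le]

theorem mem_bext_iff {x : E4} : x ∈ boostedKerrExterior 1 0 P.M 0 ↔ 2 * P.M < Kerr.radius 0 x := by
  rw [mem_boostedKerrExterior, poincareInv_one_zero, mem_exterior_iff]

theorem hbext : boostedKerrExterior 1 0 P.M 0 ≤ Kerr.region 0 P.r₀ := by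
  rw [boostedKerrExterior_one_zero]
  exact hext P

theorem hUext : (Minkowski.backgroundOn (U P)).domain ≤ (Kerr.background P.M 0).domain := by
  intro x hx
  change x ∈ Kerr.exterior P.M 0
  rw [mem_exterior_iff]
  exact (two_M_lt_ρ P (x 0)).trans hx.2

theorem hUreg : U P ≤ Kerr.region 0 P.r₀ := fun _ hx ↦ hext P (hUext P hx)

/-- The identity Kerr chart `{r > 2M} ↪ {r > r₀}`. -/
def ΨK : (Kerr.background P.M 0).domain → (ST P).carrier := Opens.inclusion (hext P)

/-- The hole chart: the identity on the boosted exterior of the trivial motion `(1, 0)`. -/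
def Ψ : (boostedKerrBackground 1 0 P.M 0).domain → (ST P).carrier := Opens.inclusion (hbext P)

/-- The flat chart: the identity Kerr chart restricted to `U`. -/
def Φ : (Minkowski.backgroundOn (U P)).domain → (ST P).carrier := ΨK P ∘ Opens.inclusion (hUext P)

/-- The region: the Schwarzschild exterior `{r > 2M}` inside the patch. -/
def O : Set (ST P).carrier := {x | 2 * P.M < Kerr.radius 0 x.1}

@[simp] theorem Ψ_val (x : (boostedKerrBackground 1 0 P.M 0).domain) : (Ψ P x).1 = x.1 := rfl
@[simp] theorem ΨK_val (x : (Kerr.background P.M 0).domain) : (ΨK P x).1 = x.1 := rfl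
@[simp] theorem Φ_val (y : (Minkowski.backgroundOn (U P)).domain) : (Φ P y).1 = y.1 := rfl

theorem mem_O {x : (ST P).carrier} : x ∈ O P ↔ 2 * P.M < Kerr.radius 0 x.1 := Iff.rfl

/-- The deviation of the identity hole chart from boosted Kerr `(1, 0)` vanishes identically. -/
theorem deviation_Ψ (x : (boostedKerrBackground 1 0 P.M 0).domain) :
    (ST P).deviation (boostedKerrBackground 1 0 P.M 0) (Ψ P) x = 0 := by
  ext v w
  rw [Spacetime.deviation_apply]
  have e1 : mfderiv 𝓘(ℝ, E4) (𝓡 4) (Ψ P) x v = v := OpensChart.mfderiv_inclusion_apply (hbext P) x v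
  have e2 : mfderiv 𝓘(ℝ, E4) (𝓡 4) (Ψ P) x w = w := OpensChart.mfderiv_inclusion_apply (hbext P) x w
  rw [e1, e2]
  change Kerr.bilin P.M 0 x.1 v w - boostedKerrBilin 1 0 P.M 0 x.1 v w = 0
  rw [boostedKerrBilin_one_zero]
  exact sub_self _

theorem deviationExtend_Ψ : (ST P).deviationExtend (boostedKerrBackground 1 0 P.M 0) (Ψ P) = 0 := by
  funext z
  by_cases hz : z ∈ (boostedKerrBackground 1 0 P.M 0).domain
  · have := (ST P).deviationExtend_coe (boostedKerrBackground 1 0 P.M 0) (Ψ P) ⟨z, hz⟩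
    rw [deviation_Ψ] at this
    exact this
  · exact (ST P).deviationExtend_of_not_mem _ _ hz

/-- The deviation of the identity Kerr chart from Kerr vanishes identically. -/
theorem deviation_ΨK (x : (Kerr.background P.M 0).domain) :
    (ST P).deviation (Kerr.background P.M 0) (ΨK P) x = 0 := by
  ext v w
  rw [Spacetime.deviation_apply]
  have e1 : mfderiv 𝓘(ℝ, E4) (𝓡 4) (ΨK P) x v = v := OpensChart.mfderiv_inclusion_apply (hext P) x v
  have e2 : mfderiv 𝓘(ℝ, E4) (𝓡 4) (ΨK P) x w = w := OpensChart.mfderiv_inclusion_apply (hext P) x w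
  rw [e1, e2]
  exact sub_self _

theorem deviationExtend_ΨK : (ST P).deviationExtend (Kerr.background P.M 0) (ΨK P) = 0 := by
  funext z
  by_cases hz : z ∈ (Kerr.background P.M 0).domain
  · have := (ST P).deviationExtend_coe (Kerr.background P.M 0) (ΨK P) ⟨z, hz⟩
    rw [deviation_ΨK] at this
    exact this
  · exact (ST P).deviationExtend_of_not_mem _ _ hz

/-- Late-time chart property of an inclusion of open subsets of `E4` into the patch. -/
theorem isLateChart_inclusion (B : ModelBackground) (hV : B.domain ≤ Kerr.region 0 P.r₀)
    (htime : Continuous B.time)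
    (hO : ∀ x : B.domain, 0 < B.time x.1 → 2 * P.M < Kerr.radius 0 x.1) :
    (ST P).IsLateChart B (O P) 0 (Opens.inclusion hV : B.domain → (ST P).carrier) := by
  refine ⟨contMDiff_inclusion (n := ∞) hV, ?_, ?_⟩
  · have hlate : IsOpen (B.lateRegion 0) :=
      isOpen_lt continuous_const (htime.comp continuous_subtype_val)
    have hg : IsOpenEmbedding (fun x : B.lateRegion 0 ↦ (x.1.1 : E4)) :=
      B.domain.2.isOpenEmbedding_subtypeVal.comp hlate.isOpenEmbedding_subtypeVal
    have hcar : IsOpenEmbedding (Subtype.val : (ST P).carrier → E4) :=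
      (Kerr.region 0 P.r₀).2.isOpenEmbedding_subtypeVal
    exact IsOpenEmbedding.of_comp _ hcar hg
  · rintro _ ⟨x, hx, rfl⟩
    exact hO x hx

theorem isLateChart_ΨK : (ST P).IsLateChart (Kerr.background P.M 0) (O P) 0 (ΨK P) :=
  isLateChart_inclusion P _ (hext P) (PiLp.continuous_apply 2 _ 0) fun x _ ↦
    (mem_exterior_iff P).mp x.2

theorem isLateChart_Ψ : (ST P).IsLateChart (boostedKerrBackground 1 0 P.M 0) (O P) 0 (Ψ P) :=
  isLateChart_inclusion P _ (hbext P)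
    ((PiLp.continuous_apply 2 _ 0).comp (continuous_poincareInv 1 0)) fun x _ ↦
    (mem_bext_iff P).mp x.2

theorem isLateChart_Φ : (ST P).IsLateChart (Minkowski.backgroundOn (U P)) (O P) 0 (Φ P) :=
  (ST P).isLateChart_backgroundOn_comp_inclusion (isLateChart_ΨK P) (hUext P)

theorem deviationCk_ΨK (k : ℕ) (τ : ℝ) : (ST P).deviationCk (Kerr.background P.M 0) (ΨK P) k τ = 0 := by
  rw [Spacetime.deviationCk, deviationExtend_ΨK, supCkENorm_zero]

theorem truncDeviationCk_Ψ (k : ℕ) (R τ : ℝ) :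
    (ST P).truncDeviationCk (boostedKerrBackground 1 0 P.M 0) (Ψ P) k R τ = 0 := by
  rw [Spacetime.truncDeviationCk, deviationExtend_Ψ, supCkENorm_zero]

theorem ρ_div_tendsto : Tendsto (fun t ↦ ρ P t / t) atTop (𝓝 0) := by
  have h1 : Tendsto (fun t : ℝ ↦ (P.R₀ + 1) / t) atTop (𝓝 0) :=
    tendsto_const_nhds.div_atTop tendsto_id
  have h2 : Tendsto (fun t : ℝ ↦ √t / t) atTop (𝓝 0) := by
    simp_rw [Real.sqrt_div_self]
    exact tendsto_inv_atTop_zero.comp Real.tendsto_sqrt_atTop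
  have := h1.add h2
  simp only [add_zero] at this
  refine this.congr' ?_
  filter_upwards with t
  simp only [ρ]
  ring

theorem ρ_tendsto_atTop : Tendsto (ρ P) atTop atTop :=
  tendsto_atTop_add_const_left _ _ Real.tendsto_sqrt_atTop

/-- Vertical displacement inside the patch keeps the radius. -/
theorem mem_region_add_smul (x : (ST P).carrier) (s : ℝ) :
    x.1 + s • E4.basisVector 0 ∈ Kerr.region 0 P.r₀ := by
  show max P.r₀ 0 < Kerr.radius 0 (x.1 + s • E4.basisVector 0)
  rw [Schw.radius_add_smul_e0]
  exact x.2

/-- The vertical translate `x + s ∂₀` as a point of the patch. -/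
def up (x : (ST P).carrier) (s : ℝ) : (ST P).carrier := ⟨x.1 + s • E4.basisVector 0, mem_region_add_smul P x s⟩

@[simp] theorem up_val (x : (ST P).carrier) (s : ℝ) : (up P x s).1 = x.1 + s • E4.basisVector 0 := rfl
theorem up_zero_apply (x : (ST P).carrier) (s : ℝ) : (up P x s).1 0 = x.1 0 + s := by simp [up]
theorem radius_up (x : (ST P).carrier) (s : ℝ) : Kerr.radius 0 (up P x s).1 = Kerr.radius 0 x.1 :=
  Schw.radius_add_smul_e0 0 x.1 s

theorem up_mem_causalFuture (x : (ST P).carrier) (hx : x ∈ O P) {s : ℝ} (hs : 0 ≤ s) :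
    up P x s ∈ (ST P).metric.causalFuture (ST P).timeOrientation {x} :=
  Schw.vertical_mem_causalFuture (hM := P.hM.le) x hx hs _

theorem up_mem_chronologicalFuture (x : (ST P).carrier) (hx : x ∈ O P) {s : ℝ} (hs : 0 < s) :
    up P x s ∈ (ST P).metric.chronologicalFuture (ST P).timeOrientation {x} :=
  Schw.vertical_mem_chronologicalFuture (hM := P.hM.le) x hx hs _

theorem mem_causalPast_up (x : (ST P).carrier) (hx : x ∈ O P) {s : ℝ} (hs : 0 ≤ s) :
    x ∈ (ST P).metric.causalPast (ST P).timeOrientation {up P x s} :=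
  mem_causalPast_of_mem_causalFuture (up_mem_causalFuture P x hx hs)

/-- A point of the exterior with coordinate `y ∈ E4` is the hole-chart image of `y`. -/
theorem eq_Ψ (x : (ST P).carrier) (hx : x ∈ O P) :
    ∃ hx' : x.1 ∈ (boostedKerrBackground 1 0 P.M 0).domain, Ψ P ⟨x.1, hx'⟩ = x :=
  ⟨(mem_bext_iff P).mpr hx, Subtype.ext rfl⟩

/-- The `N = 1` exact Schwarzschild decomposition of the exterior `O = {r > 2M}` of the patch
`{r > r₀}`: motion `(1, 0)`, identity hole chart, flat chart the identity on
`U = {x⁰ > −1, r > R₀ + 1 + √x⁰}`, `τ₀ = 0`. -/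
def decomp : FinalStateDecomposition (ST P) (O P) 2 where
  N := 1
  mass _ := P.M
  spin _ := 0
  mass_pos _ := P.hM
  abs_spin_le_mass _ := by rw [abs_zero]; exact P.hM.le
  motion _ := (1, 0)
  τ₀ := 0
  chart _ := Ψ P
  isLateChart _ := isLateChart_Ψ P
  tendsto_truncDeviationCk _ R := by
    simp_rw [truncDeviationCk_Ψ]
    exact tendsto_const_nhds
  exists_pairwise_disjoint _ := ⟨0, Subsingleton.pairwise⟩
  excision _ := ρ P
  tendsto_excision_div _ := ρ_div_tendsto P
  flatDomain := U P
  setOf_lt_excision_subset_flatDomain := by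
    rintro x ⟨hx0, hx⟩
    have h := hx 0
    rw [poincareInv_one_zero] at h
    exact ⟨by linarith, h⟩
  flatChart := Φ P
  isLateChart_flat := isLateChart_Φ P
  tendsto_deviationCk_flat := by
    refine (ST P).tendsto_deviationCk_backgroundOn (isLateChart_ΨK P).contMDiff ?_
      (ρ_tendsto_atTop P) (fun z (hz : z ∈ U P) ↦ hz.2) (hUext P)
    simp_rw [deviationCk_ΨK]
    exact tendsto_const_nhds
  diff_subset_causalPast := by
    rintro p ⟨hpO, hpn⟩
    -- `p⁰ ≤ 0`, otherwise `p` is hole-late charted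
    have hp0 : p.1 0 ≤ 0 := by
      by_contra h
      push Not at h
      apply hpn
      refine Or.inl (mem_iUnion.mpr ⟨0, ?_⟩)
      obtain ⟨hp', hpeq⟩ := eq_Ψ P p hpO
      refine ⟨⟨p.1, hp'⟩, ?_, hpeq⟩
      show 0 < poincareInv 1 0 p.1 0
      rwa [poincareInv_one_zero]
    -- flow up to time `0`, landing on the initial hole slab
    set s : ℝ := -p.1 0 with hs
    have hs0 : 0 ≤ s := by linarith
    refine causalFuture_mono (singleton_subset_iff.mpr ?_) (mem_causalPast_up P p hpO hs0)
    refine Or.inl (mem_iUnion.mpr ⟨(0 : Fin 1), ?_⟩)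
    have hqO : up P p s ∈ O P := by rw [mem_O, radius_up]; exact hpO
    obtain ⟨hq', hqeq⟩ := eq_Ψ P (up P p s) hqO
    refine ⟨⟨(up P p s).1, hq'⟩, ?_, hqeq⟩
    show poincareInv 1 0 (up P p s).1 0 = 0
    rw [poincareInv_one_zero, up_zero_apply, hs]
    ring


/-! ### The clause set `HonestCore ∧ Seamed`, exhaustion, and the `O`-shape in the model -/

theorem decomp_N : (decomp P).N = 1 := rfl
theorem decomp_τ₀ : (decomp P).τ₀ = 0 := rfl
theorem decomp_chart (i : Fin (decomp P).N) : (decomp P).chart i = Ψ P := rfl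
theorem decomp_background (i : Fin (decomp P).N) :
    (decomp P).background i = boostedKerrBackground 1 0 P.M 0 := rfl
theorem decomp_flatDomain : (decomp P).flatDomain = U P := rfl
theorem decomp_flatChart : (decomp P).flatChart = Φ P := rfl
theorem decomp_excision (i : Fin (decomp P).N) : (decomp P).excision i = ρ P := rfl

instance : Subsingleton (Fin (decomp P).N) := show Subsingleton (Fin 1) from inferInstance
instance : Inhabited (Fin (decomp P).N) := show Inhabited (Fin 1) from inferInstance

@[simp] theorem bg_time (x : E4) : (boostedKerrBackground 1 0 P.M 0).time x = x 0 := by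
  show poincareInv 1 0 x 0 = x 0
  rw [poincareInv_one_zero]

@[simp] theorem bg_radius (x : E4) :
    (boostedKerrBackground 1 0 P.M 0).radius x = Kerr.radius 0 x := by
  show Kerr.radius 0 (poincareInv 1 0 x) = _
  rw [poincareInv_one_zero]

theorem motion_e0 : (((1 : lorentzGroup) : E4 ≃L[ℝ] E4) (E4.basisVector 0)) = E4.basisVector 0 := rfl

theorem Φ_eq : Φ P = Opens.inclusion (hUreg P) := rfl

/-- A hole-domain point is in the exterior. -/
theorem Ψ_mem_O (x : (boostedKerrBackground 1 0 P.M 0).domain) : Ψ P x ∈ O P :=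
  (mem_bext_iff P).mp x.2

theorem Φ_mem_O (y : (Minkowski.backgroundOn (U P)).domain) : Φ P y ∈ O P :=
  (two_M_lt_ρ P (y.1 0)).trans y.2.2

/-- `HonestCore` holds in the model. -/
theorem honestCore_decomp : HonestCore (ST P) (O P) 2 (decomp P) P.R₀ := by
  refine ⟨fun i ↦ ⟨?_, P.hR₀, ?_⟩, ?_, ?_, ?_⟩
  · -- (a) sub-extremal
    show |(0 : ℝ)| < P.M
    rw [abs_zero]; exact P.hM
  · -- (a) orthochronous
    show (0 : ℝ) < (((1 : lorentzGroup) : E4 ≃L[ℝ] E4) (E4.basisVector 0)) 0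
    rw [motion_e0]
    simp
  · -- (b) anchoring by the static flow
    rintro i ϱ τ₂ - - _ ⟨x, ⟨-, hxτ, hxr⟩, rfl⟩
    simp only [decomp_background, bg_time, bg_radius] at hxτ hxr
    set s : ℝ := τ₂ - x.1 0 with hs
    have hs0 : 0 ≤ s := by linarith
    have hqO : up P (Ψ P x) s ∈ O P := by rw [mem_O, radius_up]; exact Ψ_mem_O P x
    refine causalFuture_mono (singleton_subset_iff.mpr ?_) (mem_causalPast_up P _ (Ψ_mem_O P x) hs0)
    obtain ⟨hq', hqeq⟩ := eq_Ψ P (up P (Ψ P x) s) hqO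
    refine ⟨⟨(up P (Ψ P x) s).1, hq'⟩, ⟨?_, ?_⟩, hqeq⟩
    · show poincareInv 1 0 (up P (Ψ P x) s).1 0 = τ₂
      rw [poincareInv_one_zero, up_zero_apply, Ψ_val, hs]; ring
    · show Kerr.radius 0 (poincareInv 1 0 (up P (Ψ P x) s).1) ≤ ϱ
      rw [poincareInv_one_zero, radius_up, Ψ_val]; exact hxr.le
  · -- (c) relative closedness in `O`
    intro i τ' ϱ hϱ _ A z hz
    obtain ⟨hzc, hzO⟩ := hz
    set C : Set E4 := {w | τ' ≤ w 0 ∧ Kerr.radius 0 w ≤ ϱ (w 0)} with hC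
    have hCc : IsClosed C :=
      (isClosed_le continuous_const (PiLp.continuous_apply 2 _ 0)).inter
        (isClosed_le (Kerr.continuous_radius 0) (hϱ.comp (PiLp.continuous_apply 2 _ 0)))
    have hsub : (decomp P).chart i '' {x | τ' ≤ ((decomp P).background i).time x.1 ∧
        ((decomp P).background i).radius x.1 ≤ ϱ (((decomp P).background i).time x.1)} ⊆
        Subtype.val ⁻¹' C := by
      rintro _ ⟨x, ⟨h1, h2⟩, rfl⟩
      simp only [decomp_background, bg_time, bg_radius] at h1 h2
      exact ⟨h1, h2⟩
    have hz1 : z.1 ∈ C := closure_minimal hsub (hCc.preimage continuous_subtype_val) hzc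
    obtain ⟨hzt, hzr⟩ := hz1
    obtain ⟨hz', hzeq⟩ := eq_Ψ P z hzO
    refine ⟨⟨z.1, hz'⟩, ?_, hzeq⟩
    show τ' ≤ (boostedKerrBackground 1 0 P.M 0).time z.1 ∧
      (boostedKerrBackground 1 0 P.M 0).radius z.1 ≤ ϱ ((boostedKerrBackground 1 0 P.M 0).time z.1)
    rw [bg_time, bg_radius]
    exact ⟨hzt, hzr⟩
  · -- (d) the flat chart is future oriented
    intro y hy
    have hrad : 2 * P.M < Kerr.radius 0 (Φ P y).1 := Φ_mem_O P y
    exact (congrArg (fun w : E4 ↦ (ST P).timeOrientation.IsFutureDirected (x := Φ P y) w)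
      (OpensChart.mfderiv_inclusion_apply (hUreg P) y (E4.basisVector 0))).mpr
        (Schw.isFutureDirected_e0 (hM := P.hM.le) (Φ P y) hrad)

/-- `Seamed` (all twelve conjuncts) holds in the model with the constant family `R i = Rc`, given the
order-zero Kerr–Schild tail bound `‖g_M − η‖ ≤ 1/10` on `{r ≥ R₀}` (which holds for `R₀` large,
`Kerr.norm_iteratedFDeriv_ksPert_le`). -/
theorem seamed_decomp
    (htail : ∀ x : E4, P.R₀ ≤ Kerr.radius 0 x → ‖Kerr.bilin P.M 0 x - Minkowski.bilin‖ ≤ 10⁻¹) :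
    Seamed (ST P) (O P) (decomp P) (fun _ ↦ Rc P) P.R₀ := by
  refine ⟨fun i ↦ ⟨monotone_Rc P, continuous_Rc P, fun s ↦ ⟨?_, ?_⟩⟩, ?_, ?_, ?_, ?_, ?_, ?_, ?_, ?_,
    ?_, ?_, ?_⟩
  · show P.R₀ + 4 ≤ Rc P s
    unfold Rc; linarith [Real.sqrt_nonneg s]
  · show P.R₀ ≤ ρ P s
    linarith [ρ_ge P s]
  · -- (2) certification to radius `Rc`: the deviation vanishes identically
    intro i
    show Tendsto (fun τ ↦ (ST P).truncDeviationCk (boostedKerrBackground 1 0 P.M 0) (Ψ P) 2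
      (Rc P τ) τ) atTop (𝓝 0)
    simp_rw [truncDeviationCk_Ψ]
    exact tendsto_const_nhds
  · -- (3) flat `C⁰` threshold: the Kerr–Schild tail beyond `R₀`
    show supCkENorm (Subtype.val '' {y : (U P) | (0 : ℝ) ≤ y.1 0}) 0
      ((ST P).deviationExtend (Minkowski.backgroundOn (U P)) (ΨK P ∘ Opens.inclusion (hUext P))) ≤ 10⁻¹
    refine iSup₂_le fun m hm ↦ iSup₂_le fun z hz ↦ ?_
    obtain ⟨y, -, rfl⟩ := hz
    have hm0 : m = 0 := Nat.le_zero.mp hm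
    subst hm0
    rw [← ofReal_norm, norm_iteratedFDeriv_zero,
      (ST P).deviationExtend_backgroundOn_comp_inclusion (hUext P) (isLateChart_ΨK P).contMDiff y.2,
      deviationExtend_ΨK, Pi.zero_apply, zero_add]
    have hr : P.R₀ ≤ Kerr.radius 0 y.1 := by linarith [ρ_ge P (y.1 0), y.2.2]
    calc ENNReal.ofReal ‖Kerr.bilin P.M 0 y.1 - Minkowski.bilin‖
        ≤ ENNReal.ofReal (10⁻¹ : ℝ) := ENNReal.ofReal_le_ofReal (htail y.1 hr)
      _ = 10⁻¹ := by rw [ENNReal.ofReal_inv_of_pos (by norm_num), ENNReal.ofReal_ofNat]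
  · -- (4) hole `C⁰` threshold: the deviation vanishes identically
    intro i
    show supCkENorm _ 0 ((ST P).deviationExtend (boostedKerrBackground 1 0 P.M 0) (Ψ P)) ≤ _
    rw [deviationExtend_Ψ, supCkENorm_zero]
    exact bot_le
  · -- (5) hole time-lines `Λ e₀ = e₀` are future directed on `r ≥ R₀ > 2M`
    intro i x _ hR₀ _
    simp only [decomp_background, bg_radius] at hR₀
    have hrad : 2 * P.M < Kerr.radius 0 (Ψ P x).1 := by
      rw [Ψ_val]; linarith [P.two_M_lt_R₀]
    show (ST P).timeOrientation.IsFutureDirected (x := Ψ P x)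
      (mfderiv 𝓘(ℝ, E4) (𝓡 4) (Ψ P) x ((((1 : lorentzGroup) : E4 ≃L[ℝ] E4) (E4.basisVector 0))))
    rw [motion_e0]
    exact (congrArg (fun w : E4 ↦ (ST P).timeOrientation.IsFutureDirected (x := Ψ P x) w)
      (OpensChart.mfderiv_inclusion_apply (hbext P) x (E4.basisVector 0))).mpr
        (Schw.isFutureDirected_e0 (hM := P.hM.le) (Ψ P x) hrad)
  · -- (6) ONE ATLAS: both charts are the identity
    intro i y hy hy0 hρ _
    change (0 : ℝ) ≤ y 0 at hy0
    have h := hρ i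
    simp only [decomp_excision, decomp_background, bg_radius] at h
    exact ⟨⟨by linarith, h⟩, Subtype.ext rfl⟩
  · -- (7) flat-late domain points lie outside the flat tubes
    intro y _ j
    show ρ P (y.1 0) < (boostedKerrBackground 1 0 P.M 0).radius y.1
    rw [bg_radius]
    exact y.2.2
  · -- (8) flat tubes deep inside certified tubes: `ρ + 2 ≤ Rc = ρ + 3`
    intro j y _ hr
    show (boostedKerrBackground 1 0 P.M 0).radius y + 2 ≤ Rc P ((boostedKerrBackground 1 0 P.M 0).time y)
    change (boostedKerrBackground 1 0 P.M 0).radius y ≤ ρ P (y 0) at hr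
    rw [bg_time, Rc_eq]
    linarith
  · -- (9) clock lag: hole time = flat time
    intro j y _ _
    show (boostedKerrBackground 1 0 P.M 0).time y ≤ y 0
    rw [bg_time]
  · -- (10) far hole leaves are flat-late points
    rintro j _ ⟨x, ⟨hx0, hxr⟩, rfl⟩
    simp only [decomp_background, bg_time, bg_radius] at hx0 hxr
    change (0 : ℝ) < x.1 0 at hx0
    have hxU : x.1 ∈ U P := ⟨by linarith, by rw [Rc_eq] at hxr; linarith⟩
    exact ⟨⟨x.1, hxU⟩, hx0, Subtype.ext rfl⟩
  · -- (11) closures of closed flat-late slabs: flat points and hole-charted tube walls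
    intro τ' hτ' z hz
    change (0 : ℝ) < τ' at hτ'
    set C : Set E4 := {w | τ' ≤ w 0 ∧ ρ P (w 0) ≤ Kerr.radius 0 w} with hC
    have hCc : IsClosed C :=
      (isClosed_le continuous_const (PiLp.continuous_apply 2 _ 0)).inter
        (isClosed_le ((continuous_ρ P).comp (PiLp.continuous_apply 2 _ 0)) (Kerr.continuous_radius 0))
    have hsub : (decomp P).flatChart '' {y | τ' ≤ y.1 0} ⊆ Subtype.val ⁻¹' C := by
      rintro _ ⟨y, hy, rfl⟩
      exact ⟨hy, y.2.2.le⟩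
    have hz1 : z.1 ∈ C := closure_minimal hsub (hCc.preimage continuous_subtype_val) hz
    obtain ⟨hzt, hzr⟩ := hz1
    rcases hzr.lt_or_eq with hlt | heq
    · left
      have hzU : z.1 ∈ U P := ⟨by linarith, hlt⟩
      exact ⟨⟨z.1, hzU⟩, hzt, Subtype.ext rfl⟩
    · right
      refine mem_iUnion.mpr ⟨default, ?_⟩
      have hzO : z ∈ O P := by rw [mem_O, ← heq]; exact two_M_lt_ρ P _
      obtain ⟨hz', hzeq⟩ := eq_Ψ P z hzO
      refine ⟨⟨z.1, hz'⟩, ⟨hzt, ?_⟩, hzeq⟩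
      show (boostedKerrBackground 1 0 P.M 0).radius z.1 = ρ P (z.1 0)
      rw [bg_radius, heq]
  · -- (12) one hole: vacuous
    intro j j' _ hjj'
    exact absurd (Subsingleton.elim j j') hjj'

/-- Exhaustion holds in the model (the honest Schwarzschild exterior settles to itself): by the
static flow every exterior point below chart time `τ₁` reaches the certified slab, and every point
above it is certified late. -/
theorem hasExhaustiveCharts_decomp : HasExhaustiveCharts (decomp P) := by
  refine ⟨fun _ ↦ Rc P, fun i ↦ ?_, fun τ₁ hτ₁ p hp ↦ ?_⟩
  · show Tendsto (fun τ ↦ (ST P).truncDeviationCk (boostedKerrBackground 1 0 P.M 0) (Ψ P) 2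
      (Rc P τ) τ) atTop (𝓝 0)
    simp_rw [truncDeviationCk_Ψ]
    exact tendsto_const_nhds
  change (0 : ℝ) < τ₁ at hτ₁
  obtain ⟨hpO, hpF⟩ := hp
  rcases le_or_gt (p.1 0) τ₁ with hle | hgt
  · -- flow up to chart time `τ₁`
    set s : ℝ := τ₁ - p.1 0 with hs
    have hs0 : 0 ≤ s := by linarith
    have hqO : up P p s ∈ O P := by rw [mem_O, radius_up]; exact hpO
    have hq0 : (up P p s).1 0 = τ₁ := by rw [up_zero_apply, hs]; ring
    refine causalFuture_mono (singleton_subset_iff.mpr ?_) (mem_causalPast_up P p hpO hs0)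
    by_cases hr : ρ P τ₁ < Kerr.radius 0 p.1
    · -- on the flat slab
      left
      have hqU : (up P p s).1 ∈ U P := ⟨by rw [hq0]; linarith, by rw [hq0, radius_up]; exact hr⟩
      exact ⟨⟨(up P p s).1, hqU⟩, hq0, Subtype.ext rfl⟩
    · -- on the hole disc
      right
      refine mem_iUnion.mpr ⟨default, ?_⟩
      obtain ⟨hq', hqeq⟩ := eq_Ψ P (up P p s) hqO
      refine ⟨⟨(up P p s).1, hq'⟩, ⟨?_, ?_⟩, hqeq⟩
      · show (boostedKerrBackground 1 0 P.M 0).time (up P p s).1 = τ₁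
        rw [bg_time, hq0]
      · show (boostedKerrBackground 1 0 P.M 0).radius (up P p s).1 ≤ Rc P τ₁
        rw [bg_radius, radius_up, Rc_eq]
        linarith [not_lt.mp hr]
  · -- above `τ₁` every exterior point is certified late
    exfalso
    apply hpF
    by_cases hr : ρ P (p.1 0) < Kerr.radius 0 p.1
    · left
      have hpU : p.1 ∈ U P := ⟨by linarith, hr⟩
      exact ⟨⟨p.1, hpU⟩, hgt, Subtype.ext rfl⟩
    · right
      refine mem_iUnion.mpr ⟨default, ?_⟩
      obtain ⟨hp', hpeq⟩ := eq_Ψ P p hpO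
      refine ⟨⟨p.1, hp'⟩, ⟨?_, ?_⟩, hpeq⟩
      · show τ₁ < (boostedKerrBackground 1 0 P.M 0).time p.1
        rw [bg_time]; exact hgt
      · show (boostedKerrBackground 1 0 P.M 0).radius p.1 ≤
          Rc P ((boostedKerrBackground 1 0 P.M 0).time p.1)
        rw [bg_radius, bg_time, Rc_eq]
        linarith [not_lt.mp hr]

/-- Every exterior point lies in the chronological past of the charted (late) region: flow up along
`∂₀` past chart time `0`. -/
theorem mem_chronologicalPast_charted (x : (ST P).carrier) (hx : x ∈ O P) :
    x ∈ (ST P).metric.chronologicalPast (ST P).timeOrientation (decomp P).charted := by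
  set s : ℝ := |x.1 0| + 1 with hs
  have hs0 : 0 < s := by positivity
  have hqO : up P x s ∈ O P := by rw [mem_O, radius_up]; exact hx
  have hq : up P x s ∈ (decomp P).charted := by
    refine FinalStateDecomposition.region_subset_charted _ default ?_
    obtain ⟨hq', hqeq⟩ := eq_Ψ P (up P x s) hqO
    refine ⟨⟨(up P x s).1, hq'⟩, ?_, hqeq⟩
    show (0 : ℝ) < (boostedKerrBackground 1 0 P.M 0).time (up P x s).1
    rw [bg_time, up_zero_apply, hs]
    linarith [neg_abs_le (x.1 0)]
  have h1 := mem_chronologicalPast_of_mem_chronologicalFuture (up_mem_chronologicalFuture P x hx hs0)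
  exact chronologicalFuture_mono (singleton_subset_iff.mpr hq) h1

/-- For `r₀ = 2M` (the exterior patch) the region is everything ... -/
theorem O_eq_univ (h : P.r₀ = 2 * P.M) : O P = univ := by
  refine eq_univ_of_forall fun x ↦ ?_
  have hx := Kerr.lt_radius_of_mem_region x.2
  show 2 * P.M < Kerr.radius 0 x.1
  linarith

/-- ... and it has the shape `J⁺(Σ) ∩ I⁻(charted)` of the crux (`Σ = univ`). -/
theorem O_eq_core (h : P.r₀ = 2 * P.M) :
    O P = (ST P).metric.causalFuture (ST P).timeOrientation univ ∩
      (ST P).metric.chronologicalPast (ST P).timeOrientation (decomp P).charted := by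
  refine Subset.antisymm (fun x hx ↦ ⟨subset_causalFuture _ _ _ (mem_univ x),
    mem_chronologicalPast_charted P x hx⟩) fun x _ ↦ ?_
  rw [O_eq_univ P h]; exact mem_univ x

/-! ### The horizon point (horizon-penetrating patch, `r₀ < 2M`) -/

/-- The points `(2, c, 0, 0)`: time `2`, radius `|c|`. -/
def zc (c : ℝ) : E4 := E4.ofTimeSpace 2 (c • EuclideanSpace.single (0 : Fin 3) (1 : ℝ))

theorem zc_apply_zero (c : ℝ) : zc c 0 = 2 := E4.ofTimeSpace_apply_zero _ _

theorem radius_zc (c : ℝ) : Kerr.radius 0 (zc c) = |c| := by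
  rw [Kerr.radius_zero_left, zc, E4.spatialNorm_ofTimeSpace, norm_smul, Real.norm_eq_abs]
  simp

theorem continuous_zc : Continuous zc :=
  (E4.continuous_ofTimeSpace 2).comp (continuous_id.smul continuous_const)

/-- The horizon point `z = (2, 2M, 0, 0)` of the patch (it exists iff `r₀ < 2M`). -/
def zH (hr₀ : P.r₀ < 2 * P.M) : (ST P).carrier :=
  ⟨zc (2 * P.M), by
    show max P.r₀ 0 < Kerr.radius 0 (zc (2 * P.M))
    rw [radius_zc, abs_of_pos P.two_M_pos, P.max_r₀]
    exact hr₀⟩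

theorem zH_zero (hr₀ : P.r₀ < 2 * P.M) : (zH P hr₀).1 0 = 2 := zc_apply_zero _

theorem radius_zH (hr₀ : P.r₀ < 2 * P.M) : Kerr.radius 0 (zH P hr₀).1 = 2 * P.M := by
  show Kerr.radius 0 (zc (2 * P.M)) = _
  rw [radius_zc, abs_of_pos P.two_M_pos]

theorem wc_pos (n : ℕ) : 0 < 2 * P.M + 1 / ((n : ℝ) + 1) := by
  have h1 := P.two_M_pos
  have h2 : (0 : ℝ) < 1 / ((n : ℝ) + 1) := by positivity
  linarith

/-- The approximating exterior points `wₙ = (2, 2M + 1/(n+1), 0, 0)`. -/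
def wn (n : ℕ) : (ST P).carrier :=
  ⟨zc (2 * P.M + 1 / ((n : ℝ) + 1)), by
    show max P.r₀ 0 < Kerr.radius 0 (zc _)
    rw [radius_zc, P.max_r₀, abs_of_pos (wc_pos P n)]
    have : (0 : ℝ) < 1 / ((n : ℝ) + 1) := by positivity
    linarith [P.hr₂]⟩

theorem radius_wn (n : ℕ) : Kerr.radius 0 (wn P n).1 = 2 * P.M + 1 / ((n : ℝ) + 1) := by
  show Kerr.radius 0 (zc _) = _
  rw [radius_zc, abs_of_pos (wc_pos P n)]

theorem wn_zero (n : ℕ) : (wn P n).1 0 = 2 := zc_apply_zero _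

theorem wn_mem_O (n : ℕ) : wn P n ∈ O P := by
  rw [mem_O, radius_wn]
  have : (0 : ℝ) < 1 / ((n : ℝ) + 1) := by positivity
  linarith

theorem radius_wn_le (n : ℕ) : Kerr.radius 0 (wn P n).1 ≤ Rc P 2 := by
  rw [radius_wn, Rc]
  have h1 : (1 : ℝ) / ((n : ℝ) + 1) ≤ 1 := by
    rw [div_le_one (by positivity)]; linarith [n.cast_nonneg (α := ℝ)]
  linarith [P.two_M_lt_R₀, Real.sqrt_nonneg (2 : ℝ)]

theorem tendsto_wn (hr₀ : P.r₀ < 2 * P.M) : Tendsto (wn P) atTop (𝓝 (zH P hr₀)) := by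
  refine ((Topology.IsEmbedding.subtypeVal
    (p := fun x : E4 ↦ x ∈ (Kerr.region (0 : ℝ) P.r₀ : Set E4))).tendsto_nhds_iff).mpr ?_
  show Tendsto (fun n : ℕ ↦ zc (2 * P.M + 1 / ((n : ℝ) + 1))) atTop (𝓝 (zc (2 * P.M)))
  have h : Tendsto (fun n : ℕ ↦ 2 * P.M + 1 / ((n : ℝ) + 1)) atTop (𝓝 (2 * P.M)) := by
    have h1 : Tendsto (fun n : ℕ ↦ (1 : ℝ) / ((n : ℝ) + 1)) atTop (𝓝 0) :=
      tendsto_one_div_add_atTop_nhds_zero_nat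
    simpa using (tendsto_const_nhds (x := 2 * P.M)).add h1
  exact (continuous_zc.tendsto _).comp h

/-- The horizon point lies in the closure of the hole-chart image of any coordinate set containing
the points `(2, 2M + 1/(n+1), 0, 0)`. -/
theorem zH_mem_closure_image (hr₀ : P.r₀ < 2 * P.M) {S : Set (boostedKerrBackground 1 0 P.M 0).domain}
    (hS : ∀ n, (⟨(wn P n).1, (mem_bext_iff P).mpr (wn_mem_O P n)⟩ :
      (boostedKerrBackground 1 0 P.M 0).domain) ∈ S) :
    zH P hr₀ ∈ closure (Ψ P '' S) := by
  refine mem_closure_of_tendsto (tendsto_wn P hr₀) (Eventually.of_forall fun n ↦ ?_)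
  exact ⟨_, hS n, Subtype.ext rfl⟩

/-- The horizon point is not charted: every charted point has `r > 2M`. -/
theorem zH_not_mem_image_Ψ (hr₀ : P.r₀ < 2 * P.M) (S : Set (boostedKerrBackground 1 0 P.M 0).domain) :
    zH P hr₀ ∉ Ψ P '' S := by
  rintro ⟨x, -, hx⟩
  have h := Ψ_mem_O P x
  rw [hx, mem_O, radius_zH] at h
  exact lt_irrefl _ h

theorem zH_not_mem_image_Φ (hr₀ : P.r₀ < 2 * P.M) (S : Set (Minkowski.backgroundOn (U P)).domain) :
    zH P hr₀ ∉ Φ P '' S := by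
  rintro ⟨y, -, hy⟩
  have h := Φ_mem_O P y
  rw [hy, mem_O, radius_zH] at h
  exact lt_irrefl _ h

/-- The horizon point `(2, 2M, 0, 0)` is in the closure of the certified late region after chart
time `1` but not in it. -/
theorem zH_mem_closure_diff (hr₀ : P.r₀ < 2 * P.M) :
    zH P hr₀ ∈ closure (certifiedLate (decomp P) (fun _ ↦ Rc P) 1) \
      certifiedLate (decomp P) (fun _ ↦ Rc P) 1 := by
  constructor
  · refine closure_mono (subset_union_right.trans' (subset_iUnion _ default)) ?_
    refine zH_mem_closure_image P hr₀ fun n ↦ ⟨?_, ?_⟩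
    · show (1 : ℝ) < (boostedKerrBackground 1 0 P.M 0).time (wn P n).1
      rw [bg_time, wn_zero]; norm_num
    · show (boostedKerrBackground 1 0 P.M 0).radius (wn P n).1 ≤
        Rc P ((boostedKerrBackground 1 0 P.M 0).time (wn P n).1)
      rw [bg_radius, bg_time, wn_zero]
      exact radius_wn_le P n
  · rintro (h | h)
    · exact zH_not_mem_image_Φ P hr₀ _ h
    · obtain ⟨i, hi⟩ := mem_iUnion.mp h
      exact zH_not_mem_image_Ψ P hr₀ _ hi

/-- The horizon point is NOT causally below the certified slab at chart time `1`: that slab lies in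
`{x⁰ = 1}` and Kerr–Schild time is a time function. -/
theorem zH_not_mem_causalPast_slab (hr₀ : P.r₀ < 2 * P.M) :
    zH P hr₀ ∉ (ST P).metric.causalPast (ST P).timeOrientation
      (certifiedSlab (decomp P) (fun _ ↦ Rc P) 1) := by
  intro h
  obtain ⟨q, hq, hle⟩ := KerrTime.time_le_of_mem_causalPast h
  rw [zH_zero] at hle
  have hq1 : q.1 0 = 1 := by
    rcases hq with ⟨y, hy, rfl⟩ | hq
    · exact hy
    · obtain ⟨i, x, hx, rfl⟩ := mem_iUnion.mp hq
      have h1 : (boostedKerrBackground 1 0 P.M 0).time x.1 = 1 := hx.1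
      rwa [bg_time] at h1
  linarith

end SchwModel

/-! ### §5 results: non-vacuity with a hole, and two absolute (un-relativised) variants refuted -/

/-- FRONTIER without `∩ O`: the closure of the certified late region, minus the region itself, is
causally below the certified slab. (The registered stub `stub_frontierBelowSlab` of
`Lines/wide-anchoring.lean` intersects the closure with `O` first; this is the variant without
that intersection.) -/
def FrontierBelowSlabAbs : Prop :=
  ∀ (𝓢 : Spacetime.{0} 4) (O : Set 𝓢.carrier) (d : FinalStateDecomposition 𝓢 O 2)
    (R : Fin d.N → ℝ → ℝ) (R₀ : ℝ), HonestCore 𝓢 O 2 d R₀ → Seamed 𝓢 O d R R₀ →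
    ∀ τ₁ : ℝ, d.τ₀ < τ₁ →
      closure (certifiedLate d R τ₁) \ certifiedLate d R τ₁ ⊆
        𝓢.metric.causalPast 𝓢.timeOrientation (certifiedSlab d R τ₁)

/-- `HonestCore` (c) without `∩ O`: late tube portions have CLOSED images. -/
def AbsoluteTubeClosedness : Prop :=
  ∀ (𝓢 : Spacetime.{0} 4) (O : Set 𝓢.carrier) (k : ℕ) (d : FinalStateDecomposition 𝓢 O k)
    (R₀ : ℝ), HonestCore 𝓢 O k d R₀ →
    ∀ (i : Fin d.N) (τ' : ℝ) (ϱ : ℝ → ℝ), Continuous ϱ → d.τ₀ < τ' →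
      IsClosed (d.chart i '' {x | τ' ≤ (d.background i).time x.1 ∧
        (d.background i).radius x.1 ≤ ϱ ((d.background i).time x.1)})

/-- Order-zero Kerr–Schild tail: for every `M` there is `R₁` with `‖g_{M,0} − η‖ ≤ 1/10` on
`{r ≥ R₁}` (from the decay of all derivatives, `Kerr.norm_iteratedFDeriv_ksPert_le`, at order `0`).
Kerr–Schild 1965, §3. [folklore] -/
theorem exists_tail_tenth (M : ℝ) :
    ∃ R₁ : ℝ, 0 < R₁ ∧ ∀ x : E4, R₁ ≤ Kerr.radius 0 x → ‖Kerr.bilin M 0 x - Minkowski.bilin‖ ≤ 10⁻¹ := by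
  obtain ⟨C, R, hR, h⟩ := Kerr.norm_iteratedFDeriv_ksPert_le M 0 0
  refine ⟨max R (10 * |C| + 1), lt_max_of_lt_left hR, fun x hx ↦ ?_⟩
  have hRx : R ≤ Kerr.radius 0 x := (le_max_left _ _).trans hx
  have hCx : 10 * |C| + 1 ≤ Kerr.radius 0 x := (le_max_right _ _).trans hx
  have hr : 0 < Kerr.radius 0 x := hR.trans_le hRx
  have h1 := h x hRx
  rw [norm_iteratedFDeriv_zero] at h1
  calc ‖Kerr.bilin M 0 x - Minkowski.bilin‖ ≤ C / Kerr.radius 0 x := h1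
    _ ≤ |C| / Kerr.radius 0 x := div_le_div_of_nonneg_right (le_abs_self C) hr.le
    _ ≤ 10⁻¹ := by
      rw [div_le_iff₀ hr]
      nlinarith [abs_nonneg C]

/-- Model parameters with the tail bound built in: mass `1`, given inner radius, `R₀` large. -/
theorem exists_params (r₀ : ℝ) (hr₀ : 0 < r₀) (hr₂ : r₀ ≤ 2) :
    ∃ P : SchwModel.Params, P.M = 1 ∧ P.r₀ = r₀ ∧
      ∀ x : E4, P.R₀ ≤ Kerr.radius 0 x → ‖Kerr.bilin P.M 0 x - Minkowski.bilin‖ ≤ 10⁻¹ := by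
  obtain ⟨R₁, hR₁, htail⟩ := exists_tail_tenth 1
  refine ⟨⟨1, r₀, max 100 R₁, one_pos, hr₀, by linarith, ?_⟩, rfl, rfl, fun x hx ↦ htail x ?_⟩
  · linarith [le_max_left (100 : ℝ) R₁]
  · exact (le_max_right _ _).trans hx

/-- **NON-VACUITY WITH A HOLE (`N = 1`).** The hypotheses of the crux — the `O`-shape
`O = J⁺(Σ) ∩ I⁻(charted)`, `HonestCore` and all twelve clauses of `Seamed` — are simultaneously
satisfiable by a decomposition with ONE hole, together with the conclusion `HasExhaustiveCharts`:
exact Schwarzschild (mass `1`) in ingoing Kerr–Schild coordinates on the exterior `{r > 2}`,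
identity hole chart, identity flat chart on `{x⁰ > −1, r > R₀ + 1 + √x⁰}`, `R(s) = R₀ + 4 + √s`,
`Σ = univ`. This is the first hole-bearing Lean witness of the clause set (the `N = 0` Minkowski
witness is `SketchIdeator1.MinkowskiN0.regressionTest`). Dafermos–Rodnianski arXiv:0811.0354, §5.1
(Schwarzschild in Kerr–Schild form). [folklore] -/
theorem exists_N_one_honest_seamed_exhaustive :
    ∃ (𝓢 : Spacetime.{0} 4) (O : Set 𝓢.carrier) (d : FinalStateDecomposition 𝓢 O 2)
      (R : Fin d.N → ℝ → ℝ) (R₀ : ℝ), d.N = 1 ∧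
      O = 𝓢.metric.causalFuture 𝓢.timeOrientation univ ∩
        𝓢.metric.chronologicalPast 𝓢.timeOrientation d.charted ∧
      HonestCore 𝓢 O 2 d R₀ ∧ Seamed 𝓢 O d R R₀ ∧ HasExhaustiveCharts d := by
  obtain ⟨P, hM, hr, htail⟩ := exists_params 2 two_pos le_rfl
  exact ⟨SchwModel.ST P, SchwModel.O P, SchwModel.decomp P, fun _ ↦ SchwModel.Rc P, P.R₀, rfl,
    SchwModel.O_eq_core P (by rw [hr, hM]; norm_num), SchwModel.honestCore_decomp P,
    SchwModel.seamed_decomp P htail, SchwModel.hasExhaustiveCharts_decomp P⟩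

/-- **The `∩ O` in FRONTIER is load-bearing.** Without intersecting the closure with `O`, the
frontier statement is FALSE: in exact Schwarzschild (mass `1`) on the horizon-penetrating patch
`{r > 1}` with `O` the exterior `{r > 2}` and identity charts (all of `HonestCore ∧ Seamed` hold),
the future-horizon point `z = (2, 2, 0, 0)` (`x⁰ = 2`, `r = 2M`) is a limit of certified hole-tube
points, is not charted, and is not in `J⁻` of the certified slab at chart time `1`, which lies in
`{x⁰ = 1}` (Kerr–Schild time is a time function, `KerrTime.time_monotoneOn`). Horizon-side limit
points are exactly what `HonestCore` (c) is relativised to `O` for. Dafermos–Rodnianski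
arXiv:0811.0354, §5.1. [folklore] -/
theorem not_frontierBelowSlabAbs : ¬ FrontierBelowSlabAbs := by
  intro h
  obtain ⟨P, hM, hr, htail⟩ := exists_params 1 one_pos (by norm_num)
  have hr₀ : P.r₀ < 2 * P.M := by rw [hr, hM]; norm_num
  have hz := h (SchwModel.ST P) (SchwModel.O P) (SchwModel.decomp P) (fun _ ↦ SchwModel.Rc P) P.R₀
    (SchwModel.honestCore_decomp P) (SchwModel.seamed_decomp P htail) 1 one_pos
    (SchwModel.zH_mem_closure_diff P hr₀)
  exact SchwModel.zH_not_mem_causalPast_slab P hr₀ hz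

/-- **`HonestCore` (c) must be relativised to `O`.** The absolute variant (closed tube images) is
incompatible with `HonestCore` itself as soon as the ambient spacetime contains the future event
horizon: same model, the horizon point `(2, 2M, 0, 0)` is in the closure of the late tube
`{1 ≤ t*, r ≤ R₀ + 4 + √2}` of the identity hole chart but has `r = 2M`. [folklore] -/
theorem not_absoluteTubeClosedness : ¬ AbsoluteTubeClosedness := by
  intro h
  obtain ⟨P, hM, hr, htail⟩ := exists_params 1 one_pos (by norm_num)
  have hr₀ : P.r₀ < 2 * P.M := by rw [hr, hM]; norm_num
  have hc := h (SchwModel.ST P) (SchwModel.O P) 2 (SchwModel.decomp P) P.R₀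
    (SchwModel.honestCore_decomp P) default 1 (fun _ ↦ SchwModel.Rc P 2) continuous_const one_pos
  have hz : SchwModel.zH P hr₀ ∈ closure ((SchwModel.decomp P).chart default ''
      {x | 1 ≤ ((SchwModel.decomp P).background default).time x.1 ∧
        ((SchwModel.decomp P).background default).radius x.1 ≤
          (fun _ ↦ SchwModel.Rc P 2) (((SchwModel.decomp P).background default).time x.1)}) := by
    refine SchwModel.zH_mem_closure_image P hr₀ fun n ↦ ⟨?_, ?_⟩
    · show (1 : ℝ) ≤ (boostedKerrBackground 1 0 P.M 0).time (SchwModel.wn P n).1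
      rw [SchwModel.bg_time, SchwModel.wn_zero]; norm_num
    · show (boostedKerrBackground 1 0 P.M 0).radius (SchwModel.wn P n).1 ≤ SchwModel.Rc P 2
      rw [SchwModel.bg_radius]
      exact SchwModel.radius_wn_le P n
  rw [hc.closure_eq] at hz
  exact SchwModel.zH_not_mem_image_Ψ P hr₀ _ hz


/-! ## §6 (cycle 2) Finite speed of light in Kerr–Schild coordinates; SEAMED (8) is load-bearing for
the landed first-contact stub -/

/-! ## Kerr–Schild light cones lie inside the Minkowski cones (`M ≥ 0`); SEAMED (8) is load-bearing
for the first-contact stub -/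

namespace KerrTime

variable {M a r₀ : ℝ} {hM : 0 ≤ M}

/-- `η(v, v) = −(v⁰)² + ‖v̲‖²`. O'Neill 1983, Ch. 3, p. 55. [folklore] -/
theorem minkowski_bilin_self (v : E4) : Minkowski.bilin v v = -(v 0) ^ 2 + E4.spatialNorm v ^ 2 := by
  rw [Minkowski.bilin_apply, E4.spatialNorm_sq, Fin.sum_univ_three]
  simp only [Fin.succ_zero_eq_one, Fin.succ_one_eq_two]
  have h3 : (2 : Fin 3).succ = (3 : Fin 4) := rfl
  rw [h3]
  ring

set_option backward.isDefEq.respectTransparency false in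
/-- Chain rule for a continuous linear functional `L` along a differentiable curve in the Kerr–Schild
patch: `L ∘ γ` has derivative `L(γ')`. [folklore] -/
theorem hasDerivAt_clm_comp (L : E4 →L[ℝ] ℝ) {γ : ℝ → (Kerr.spacetime M a r₀ hM).carrier} {s : ℝ}
    (hγ : MDifferentiableAt 𝓘(ℝ, ℝ) (𝓡 4) γ s) :
    HasDerivAt (fun s ↦ L (γ s).1) (L (show E4 from velocity (𝓡 4) γ s)) s := by
  have hφ : HasMFDerivAt (𝓡 4) 𝓘(ℝ, ℝ)
      (fun x : (Kerr.spacetime M a r₀ hM).carrier ↦ L x.1) (γ s)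
      (L.comp (ContinuousLinearMap.id ℝ E4)) :=
    L.hasMFDerivAt.comp (γ s) (hasMFDerivAt_subtypeVal (I' := 𝓡 4) (γ s))
  rw [hasDerivAt_iff_hasFDerivAt, ← hasMFDerivAt_iff_hasFDerivAt]
  apply (hφ.comp s hγ.hasMFDerivAt).congr_mfderiv
  rw [ContinuousLinearMap.ext_iff]
  intro (r : ℝ)
  have hr : (mfderiv 𝓘(ℝ, ℝ) (𝓡 4) γ s) r = r • (mfderiv 𝓘(ℝ, ℝ) (𝓡 4) γ s) (1 : ℝ) := by
    rw [← map_smul]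
    congr 1
    exact (mul_one r).symm
  change L ((mfderiv 𝓘(ℝ, ℝ) (𝓡 4) γ s) r) = r • L (show E4 from velocity (𝓡 4) γ s)
  rw [hr, map_smul, smul_eq_mul, smul_eq_mul]
  rfl

/-- **Kerr–Schild cones lie inside the Minkowski cones** (`M ≥ 0`): a `g`-causal vector is `η`-causal,
`‖v̲‖ ≤ |v⁰|`, since `g(v, v) = η(v, v) + 2H ℓ(v)²` with `H ≥ 0`. Dafermos–Rodnianski arXiv:0811.0354,
§5.1. [folklore] -/
theorem spatialNorm_le_abs_of_isCausal {x : (Kerr.spacetime M a r₀ hM).carrier} {v : E4}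
    (hv : (Kerr.spacetime M a r₀ hM).metric.IsCausal (x := x) v) : E4.spatialNorm v ≤ |v 0| := by
  have hc : Kerr.bilin M a x.1 v v ≤ 0 := hv.1
  rw [Kerr.bilin_apply, minkowski_bilin_self] at hc
  have hH := Kerr.scalarH_nonneg hM a x.1
  have hl : 0 ≤ Kerr.nullCovector a x.1 v * Kerr.nullCovector a x.1 v := mul_self_nonneg _
  have hsq : E4.spatialNorm v ^ 2 ≤ |v 0| ^ 2 := by rw [sq_abs]; nlinarith
  have h1 := Real.sqrt_le_sqrt hsq
  rwa [Real.sqrt_sq (E4.spatialNorm_nonneg v), Real.sqrt_sq (abs_nonneg _)] at h1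

/-- Along a future causal curve of the REVERSED orientation (i.e. a past-directed causal curve), for every
`e ∈ E3` with `‖e‖ ≤ 1` the function `s ↦ −x⁰(γ s) + ⟨e, x̲(γ s)⟩` is monotone: its derivative is
`−v⁰ + ⟨e, v̲⟩ ≥ −v⁰ − ‖v̲‖ ≥ 0` (cones inside Minkowski cones, `v⁰ < 0`). [folklore] -/
theorem monotoneOn_neg_time_add_inner {γ : ℝ → (Kerr.spacetime M a r₀ hM).carrier} {s₁ s₂ : ℝ}
    (hγ : (Kerr.spacetime M a r₀ hM).metric.IsFutureCausalCurveOn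
      (Kerr.spacetime M a r₀ hM).timeOrientation.reverse γ (Icc s₁ s₂)) (e : E3) (he : ‖e‖ ≤ 1) :
    MonotoneOn (fun s ↦ -(γ s).1 0 + inner ℝ e (E4.spatial (γ s).1)) (Icc s₁ s₂) := by
  set L : E4 →L[ℝ] ℝ := -EuclideanSpace.proj (0 : Fin 4) + (innerSL ℝ e).comp E4.spatial with hL
  have hLv : ∀ v : E4, L v = -v 0 + inner ℝ e (E4.spatial v) := fun v ↦ by simp [hL]
  have hcont : ContinuousOn (fun s ↦ L (γ s).1) (Icc s₁ s₂) := fun s hs ↦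
    ((L.continuous.comp continuous_subtype_val).continuousAt.comp (hγ.continuousAt hs)).continuousWithinAt
  have key : MonotoneOn (fun s ↦ L (γ s).1) (Icc s₁ s₂) := by
    refine monotoneOn_of_hasDerivWithinAt_nonneg (convex_Icc s₁ s₂) hcont
      (fun s hs ↦ (hasDerivAt_clm_comp L (hγ s (interior_subset hs)).1).hasDerivWithinAt) fun s hs ↦ ?_
    have hfd := (hγ s (interior_subset hs)).2
    set v : E4 := (show E4 from velocity (𝓡 4) γ s) with hv
    have h0 : v 0 < 0 := velocity_zero_neg hfd
    have hsp : E4.spatialNorm v ≤ |v 0| := by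
      rw [TimeOrientation.isFutureDirected_reverse_iff] at hfd
      exact spatialNorm_le_abs_of_isCausal hfd.1
    rw [abs_of_neg h0] at hsp
    have hin : |inner ℝ e (E4.spatial v)| ≤ E4.spatialNorm v := by
      refine (abs_real_inner_le_norm e _).trans ?_
      rw [E4.spatialNorm]
      exact mul_le_of_le_one_left (norm_nonneg _) he
    show (0 : ℝ) ≤ L v
    rw [hLv]
    linarith [neg_abs_le (inner ℝ e (E4.spatial v))]
  simpa only [hLv] using key

/-- **Finite speed of light in Kerr–Schild coordinates** (`M ≥ 0`): if `p ∈ J⁻(S)` then some `q ∈ S`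
has `‖q̲ − p̲‖ ≤ q⁰ − p⁰`. Dafermos–Rodnianski arXiv:0811.0354, §5.1. [folklore] -/
theorem exists_norm_spatial_sub_le_of_mem_causalPast {S : Set (Kerr.spacetime M a r₀ hM).carrier}
    {p : (Kerr.spacetime M a r₀ hM).carrier}
    (hp : p ∈ (Kerr.spacetime M a r₀ hM).metric.causalPast
      (Kerr.spacetime M a r₀ hM).timeOrientation S) :
    ∃ q ∈ S, ‖E4.spatial q.1 - E4.spatial p.1‖ ≤ q.1 0 - p.1 0 := by
  rcases hp with hp | ⟨q, hq, γ, s₁, s₂, hs, hγ, hγ₁, hγ₂⟩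
  · exact ⟨p, hp, by simp⟩
  · refine ⟨q, hq, ?_⟩
    -- for every `e` of norm ≤ 1: ⟨e, q̲ − p̲⟩ ≤ q⁰ − p⁰
    have hine : ∀ e : E3, ‖e‖ ≤ 1 → inner ℝ e (E4.spatial q.1 - E4.spatial p.1) ≤ q.1 0 - p.1 0 := by
      intro e he
      have hmono := monotoneOn_neg_time_add_inner hγ e he ⟨le_rfl, hs.le⟩ ⟨hs.le, le_rfl⟩ hs.le
      simp only at hmono
      rw [hγ₁, hγ₂] at hmono
      rw [inner_sub_right]
      linarith
    set w : E3 := E4.spatial q.1 - E4.spatial p.1 with hw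
    by_cases hw0 : w = 0
    · have h := hine 0 (by simp)
      rw [hw0, norm_zero]
      simpa using h
    · have hn : 0 < ‖w‖ := norm_pos_iff.mpr hw0
      have he : ‖‖w‖⁻¹ • w‖ ≤ 1 := by
        rw [norm_smul, norm_inv, norm_norm, inv_mul_cancel₀ hn.ne']
      have h := hine _ he
      rwa [real_inner_smul_left, real_inner_self_eq_norm_sq, pow_two, ← mul_assoc,
        inv_mul_cancel₀ hn.ne', one_mul] at h

end KerrTime

namespace SchwModel

/-- Concrete parameters: mass `1`, the exterior patch `{r > 2}`, `R₀ = 100`. -/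
def P₁ : Params := ⟨1, 2, 100, one_pos, two_pos, by norm_num, by norm_num⟩

/-- The flat-late point `y = (1/64, ρ(1/64) + 1/16, 0, 0)` just outside the flat tube at an early time. -/
def yE (P : Params) : E4 := E4.ofTimeSpace (1 / 64) ((ρ P (1 / 64) + 1 / 16) • EuclideanSpace.single (0 : Fin 3) (1 : ℝ))

variable (P : Params)

theorem yE_zero : yE P 0 = 1 / 64 := E4.ofTimeSpace_apply_zero _ _

theorem ρ_pos (t : ℝ) : 0 < ρ P t := by linarith [ρ_ge P t, P.R₀_pos]

theorem spatialNorm_yE : E4.spatialNorm (yE P) = ρ P (1 / 64) + 1 / 16 := by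
  rw [yE, E4.spatialNorm_ofTimeSpace, norm_smul, Real.norm_eq_abs, abs_of_pos (by linarith [ρ_pos P (1/64)])]
  simp

theorem yE_mem_U : yE P ∈ U P := by
  refine ⟨by rw [yE_zero]; norm_num, ?_⟩
  rw [Kerr.radius_zero_left, spatialNorm_yE, yE_zero]
  linarith

/-- `ρ(1/16) − ρ(1/64) = 1/4 − 1/8 = 1/8`: the flat tube grows faster than light near `t = 0`. -/
theorem ρ_gap : ρ P (1 / 16) - ρ P (1 / 64) = 1 / 8 := by
  have h1 : √(1 / 16 : ℝ) = 1 / 4 := by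
    rw [show (1 / 16 : ℝ) = (1 / 4) ^ 2 by norm_num, Real.sqrt_sq (by norm_num)]
  have h2 : √(1 / 64 : ℝ) = 1 / 8 := by
    rw [show (1 / 64 : ℝ) = (1 / 8) ^ 2 by norm_num, Real.sqrt_sq (by norm_num)]
  simp only [ρ, h1, h2]
  ring

/-- In the model, the flat-late point `Φ(y)` is NOT causally below the flat slab at chart time `1/16`:
a slab point has `‖x̲‖ > ρ(1/16) = ρ(1/64) + 1/8`, but light from `y` (`x⁰ = 1/64`, `‖y̲‖ = ρ(1/64) + 1/16`)
gains at most `1/16 − 1/64` in radius by then (finite speed of light in Kerr–Schild coordinates). -/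
theorem Φ_yE_not_mem_causalPast_flatSlab :
    Φ P ⟨yE P, yE_mem_U P⟩ ∉ (ST P).metric.causalPast (ST P).timeOrientation
      (Φ P '' (Minkowski.backgroundOn (U P)).timeSlab (1 / 16)) := by
  intro h
  obtain ⟨q, ⟨z, hz, rfl⟩, hle⟩ := KerrTime.exists_norm_spatial_sub_le_of_mem_causalPast h
  have hz0 : z.1 0 = 1 / 16 := hz
  have hzr : ρ P (1 / 16) < E4.spatialNorm z.1 := by
    have := z.2.2
    rwa [Kerr.radius_zero_left, hz0] at this
  rw [Φ_val, Φ_val, hz0, yE_zero] at hle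
  have htri : E4.spatialNorm z.1 - E4.spatialNorm (yE P) ≤ ‖E4.spatial z.1 - E4.spatial (yE P)‖ := by
    rw [E4.spatialNorm, E4.spatialNorm]
    exact (norm_sub_norm_le _ _)
  rw [spatialNorm_yE] at htri
  linarith [ρ_gap P]

end SchwModel

open scoped SchwModel in
/-- **SEAMED (8) is load-bearing for the first-contact stub.** The landed theorem `stub_firstContact`
of crux `stmt-FinalStateConjecture-13551` (line `wide-anchoring`; hypotheses `hd` = `HonestCore` (d),
`hR` = continuity of the radii, `h8` = SEAMED (8)) becomes FALSE when `h8` is deleted: in the exact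
Schwarzschild model (mass `1`, exterior patch, `R₀ = 100`; `hd` holds by `honestCore_decomp`) take the
radii `R ≡ 0` (continuous) , `τ₁ = 1/16` and the flat-late point `y = (1/64, ρ(1/64) + 1/16, 0, 0)`:
the RIGHT disjunct needs a flat-domain point `c` with `r(c) ≤ 0`, impossible (`r > ρ > 0` on the flat
domain), and the LEFT disjunct fails by finite speed of light (`Φ_yE_not_mem_causalPast_flatSlab`: the flat
tube `ρ(t) = R₀ + 1 + √t` outruns light near `t = 0`, which is exactly what (8) — "flat tubes lie deep
inside certified tubes" — rules out). Formalises the paper witness of drefute g3 (`DrefuteG3.md`).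
Dafermos–Rodnianski arXiv:0811.0354, §5.1. [folklore] -/
theorem not_firstContact_without_seamed8 :
    ¬ ∀ (𝓢 : Spacetime.{0} 4) (O : Set 𝓢.carrier) (d : FinalStateDecomposition 𝓢 O 2)
        (R : Fin d.N → ℝ → ℝ),
      (∀ y : d.flatDomain, d.τ₀ < y.1 0 →
        𝓢.timeOrientation.IsFutureDirected
          (mfderiv 𝓘(ℝ, E4) (𝓡 4) d.flatChart y (E4.basisVector 0))) →
      (∀ i, Continuous (R i)) →
      ∀ (τ₁ : ℝ) (y : d.flatDomain), d.τ₀ < y.1 0 → y.1 0 ≤ τ₁ →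
        d.flatChart y ∈ 𝓢.metric.causalPast 𝓢.timeOrientation
            (d.flatChart '' (Minkowski.backgroundOn d.flatDomain).timeSlab τ₁) ∨
          ∃ (c : d.flatDomain) (k : Fin d.N), d.τ₀ < c.1 0 ∧ c.1 0 ≤ τ₁ ∧
            (d.background k).radius c.1 ≤ R k ((d.background k).time c.1) ∧
            d.flatChart y ∈ 𝓢.metric.causalPast 𝓢.timeOrientation {d.flatChart c} := by
  intro h
  set P := SchwModel.P₁ with hP
  have hd := (SchwModel.honestCore_decomp P).2.2.2
  rcases h (SchwModel.ST P) (SchwModel.O P) (SchwModel.decomp P) (fun _ _ ↦ 0) hd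
      (fun _ ↦ continuous_const) (1 / 16) ⟨SchwModel.yE P, SchwModel.yE_mem_U P⟩
      (by show (0 : ℝ) < SchwModel.yE P 0; rw [SchwModel.yE_zero]; norm_num)
      (by show SchwModel.yE P 0 ≤ 1 / 16; rw [SchwModel.yE_zero]; norm_num) with hL | ⟨c, k, -, -, hcr, -⟩
  · exact SchwModel.Φ_yE_not_mem_causalPast_flatSlab P hL
  · have hc := c.2.2
    rw [SchwModel.decomp_background, SchwModel.bg_radius] at hcr
    linarith [SchwModel.ρ_pos P (c.1 0)]

end Summit.FinalStateConjecture.FinalStateConjecture.Cruxes.SeamedChartsExhaust.Disproof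

end
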